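/-
Copyright (c) 2026. All rights reserved.
Released under Apache 2.0 license as described in the file LICENSE.
-/
import Literature.NumberTheory.Automorphic.MaximalOrderDiscSevenLattice
import HarnessLib

/-!
# The Dedekind–Hasse criterion for the maximal order `O₇` of `(−1,−7 ∣ ℚ)` (Cardoso–Machiavelo 2025): for every
# `ρ ∈ B ∖ O₇` there are `α, β ∈ O₇` with `0 < nrd(ρα − β) < 1` — by kernel-checked certificates at the primes `p ≤ 13`
# and a pigeonhole argument at `p ≥ 17`

[tag: quaternion_algebra] [tag: maximal_order] [tag: class_number]

Topic `NumberTheory/Automorphic`; THEOREMS ONLY (no definition, no named fact, no instance; net Literature debt `0`).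
Lane `lit-hodgefound`, seat p12, gen 46 — third file of the series on the definite quaternion order of discriminant `7`
(`MaximalOrderDiscSevenLattice`: `O₇ = ℤ⟨1, i, ω, iω⟩ ⊂ ℍ[ℚ,−1,−7]`, `ω = (1+j)/2`, `nrd(a + bi + cω + d iω) = Q₇(a,b,c,d) :=
a² + ac + 2c² + b² + bd + 2d²`).

The maximal orders of discriminant `7` and `13` have class number one but are NOT norm-Euclidean (Voight Exercise 17.10 (c),
Thm. 25.4.1). Cardoso–Machiavelo prove `# Cls = 1` for them by the DEDEKIND–HASSE CRITERION (their Thm. 3, after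
Pollard–Diamond): an order `H` in a definite rational quaternion algebra `A` is a right PID iff

  `∀ ρ ∈ A ∖ H ∃ α, β ∈ H : 0 < N(ρα − β) < 1`,

reduced (their Prop. 2, Cor. 1, Thm. 4, Prop. 3, Thm. 7) to finitely many `ρ = δ/p` (`p` prime, `δ` mod `pH`) with `α` mod
`pH`, large primes being automatic by Hardy–Wright's simultaneous approximation (Thm. 201; their Lemma 1 and Thm. 6: for
`H₁,₇` the primes `p > 16` need no check, §5.1), and the primes `p ∈ {2, 3, 5, 7, 11, 13}` checked by a PARI/GP program (§6,
Thm. 8: «`H₁,₇` is a PID»). This file PROVES THE CRITERION'S HYPOTHESIS FOR `O₇ = H₁,₇` (in the right-multiplier form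
`ρα − β` matching the tree's right ideals `βO`), from which the sequel derives `# Cls O₇ = 1`:

* §1 coordinates: `mk_mul_negI`, `mk_mul_negOne`, `mk_mul_negIOmega`, `mk_mul_negOneNegI`, `mk_mul_intCast` (right
  multiplication by the four multipliers `−i, −1, −iω, −1−i` and by an integer `u`, in the coordinates of `O₇`),
  `centred_modEq`; **`exists_beta`** (THE REDUCTION STEP: if `c ∈ ℤ⁴` is congruent mod `p` to the coordinates of `δα` and
  `0 < Q₇(c) < p²`, then `β := (δα − c)/p ∈ O₇` has `nrd((δ/p)α − β) = Q₇(c)/p² ∈ (0,1)`), `exists_of_add_smul` (translation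
  by `pO₇`);
* §2 **the certificates** `cert_p`, `p = 2, 3, 5, 7, 11, 13` (private; `decide +kernel` over all `p⁴ − 1` residue classes
  `δ mod pO₇`, each settled by one of the four multipliers with the centred lift) and `cert_sound`, giving
  **`exists_alpha_beta_of_prime_le`** (every `δ ∈ O₇` with `δ/p ∉ O₇`, `p ≤ 13` prime, satisfies the criterion);
* §3 large primes: `exists_small_multiple` (PIGEONHOLE: for `p > 0` and `X₂, X₃ ∈ ℤ` there is `1 ≤ u ≤ 16` with `uX₂, uX₃`
  congruent mod `p` to integers `c` with `4|c| < p` — Hardy–Wright Thm. 201 with `Q = 4` in two coordinates),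
  `form_lt_sq` (`2|c₀|, 2|c₁| ≤ p−1`, `4|c₂|, 4|c₃| ≤ p−1 ⟹ Q₇(c) < p²`: `64·Q₇ = (8c₀+4c₂)² + 7(4c₂)² + (8c₁+4c₃)² + 7(4c₃)²
  ≤ 64(p−1)²`), **`exists_alpha_beta_of_seventeen_le`** (primes `p ≥ 17` with the scalar multiplier `α = u`);
* §4 **`exists_alpha_beta_of_prime`** (all primes), and the criterion itself **`dedekindHasse`**: FOR EVERY `ρ ∈ ℍ[ℚ,−1,−7] ∖ O₇`
  THERE ARE `α, β ∈ O₇` WITH `0 < nrd(ρα − β) < 1` (reduction to `ρ = δ/p`: the least denominator `n` of `ρ`, a prime `p ∣ n`,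
  `δ := nρ`, `α ↦ (n/p)α`).

## Sources

* A. Cardoso, A. Machiavelo, *The Dedekind–Hasse Criterion in Quaternion Algebras*, arXiv:2506.22651 (2025): Thm. 3 (the
  criterion), Prop. 2 and Cor. 1 (translation ∕ multiplication invariance), Thm. 4 (reduction to `δ/p`), Lemma 1, Thm. 5
  (= Hardy–Wright Thm. 201), Thm. 6 (finitely many primes), Prop. 3 and Thm. 7 (`α` mod `pH`), §5.1 and Thm. 8 («`H₁,₇` is a
  PID»: `Q ≥ 4` suffices, primes `p < 16`, «102 quaternions over six primes»), §6 (PARI/GP code).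
  [cite: CardosoMachiavelo2025, Thm. 3, Prop. 2, Cor. 1, Thm. 4, Lemma 1, Thm. 6, Thm. 7, §5.1 Thm. 8]
* G. H. Hardy, E. M. Wright, *An Introduction to the Theory of Numbers*, Thm. 201 (simultaneous approximation by the box
  principle). [cite: HardyWright2008, Thm. 201]
* J. Voight, *Quaternion Algebras*, GTM 288 (2021), Thm. 25.4.1 (`D = 7`), Exercise 17.10 (c) (not norm-Euclidean).
  [cite: Voight2021, Thm. 25.4.1 (D = 7); Exercise 17.10 (c)]

## Scope (honest)

Theorems only — no definition, no named fact, no instance. The multipliers used here (`−i, −1, −iω, −1−i` for `p ≤ 13`, an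
integer `u ≤ 16` for `p ≥ 17`) are this file's own certificate (found by a search and checked by the kernel), not the pairs
printed by the source's PARI/GP run; the equivalence "PID ⟺ criterion" (the direction ⟹ of Thm. 3) is not formalised.
-/

open Quaternion
open scoped Pointwise
open Literature.NumberTheory.Automorphic.Brandt

namespace Literature.NumberTheory.Automorphic.MaxOrderDiscSeven

/-! ## §1 Coordinates and the reduction step -/

section Coordinates

/-- Right multiplication by the multiplier `−i` (lattice coordinates `(0, -1, 0, 0)`) in the coordinates of `O₇`. [cite: CardosoMachiavelo2025, §6 (the matrix B₇)] -/
theorem mk_mul_negI (A B C D : ℤ) :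
    (⟨(A : ℚ) + (C : ℚ) / 2, (B : ℚ) + (D : ℚ) / 2, (C : ℚ) / 2, (D : ℚ) / 2⟩ : ℍ[ℚ,-1,-7]) *
        (⟨((0 : ℤ) : ℚ) + ((0 : ℤ) : ℚ) / 2, ((-1 : ℤ) : ℚ) + ((0 : ℤ) : ℚ) / 2, ((0 : ℤ) : ℚ) / 2, ((0 : ℤ) : ℚ) / 2⟩ : ℍ[ℚ,-1,-7]) =
      ⟨((B + D : ℤ) : ℚ) + ((-D : ℤ) : ℚ) / 2, ((-A - C : ℤ) : ℚ) + ((C : ℤ) : ℚ) / 2, ((-D : ℤ) : ℚ) / 2, ((C : ℤ) : ℚ) / 2⟩ := by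
  ext <;> simp [QuaternionAlgebra.mk_mul_mk] <;> ring

/-- Right multiplication by the multiplier `−1` (lattice coordinates `(-1, 0, 0, 0)`) in the coordinates of `O₇`. [cite: CardosoMachiavelo2025, §6 (the matrix B₇)] -/
theorem mk_mul_negOne (A B C D : ℤ) :
    (⟨(A : ℚ) + (C : ℚ) / 2, (B : ℚ) + (D : ℚ) / 2, (C : ℚ) / 2, (D : ℚ) / 2⟩ : ℍ[ℚ,-1,-7]) *
        (⟨((-1 : ℤ) : ℚ) + ((0 : ℤ) : ℚ) / 2, ((0 : ℤ) : ℚ) + ((0 : ℤ) : ℚ) / 2, ((0 : ℤ) : ℚ) / 2, ((0 : ℤ) : ℚ) / 2⟩ : ℍ[ℚ,-1,-7]) =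
      ⟨((-A : ℤ) : ℚ) + ((-C : ℤ) : ℚ) / 2, ((-B : ℤ) : ℚ) + ((-D : ℤ) : ℚ) / 2, ((-C : ℤ) : ℚ) / 2, ((-D : ℤ) : ℚ) / 2⟩ := by
  ext <;> simp [QuaternionAlgebra.mk_mul_mk] <;> ring

/-- Right multiplication by the multiplier `−iω` (lattice coordinates `(0, 0, 0, -1)`) in the coordinates of `O₇`. [cite: CardosoMachiavelo2025, §6 (the matrix B₇)] -/
theorem mk_mul_negIOmega (A B C D : ℤ) :
    (⟨(A : ℚ) + (C : ℚ) / 2, (B : ℚ) + (D : ℚ) / 2, (C : ℚ) / 2, (D : ℚ) / 2⟩ : ℍ[ℚ,-1,-7]) *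
        (⟨((0 : ℤ) : ℚ) + ((0 : ℤ) : ℚ) / 2, ((0 : ℤ) : ℚ) + ((-1 : ℤ) : ℚ) / 2, ((0 : ℤ) : ℚ) / 2, ((-1 : ℤ) : ℚ) / 2⟩ : ℍ[ℚ,-1,-7]) =
      ⟨((2 * D : ℤ) : ℚ) + ((B : ℤ) : ℚ) / 2, ((-2 * C : ℤ) : ℚ) + ((-A : ℤ) : ℚ) / 2, ((B : ℤ) : ℚ) / 2, ((-A : ℤ) : ℚ) / 2⟩ := by
  ext <;> simp [QuaternionAlgebra.mk_mul_mk] <;> ring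

/-- Right multiplication by the multiplier `−1 − i` (lattice coordinates `(-1, -1, 0, 0)`) in the coordinates of `O₇`. [cite: CardosoMachiavelo2025, §6 (the matrix B₇)] -/
theorem mk_mul_negOneNegI (A B C D : ℤ) :
    (⟨(A : ℚ) + (C : ℚ) / 2, (B : ℚ) + (D : ℚ) / 2, (C : ℚ) / 2, (D : ℚ) / 2⟩ : ℍ[ℚ,-1,-7]) *
        (⟨((-1 : ℤ) : ℚ) + ((0 : ℤ) : ℚ) / 2, ((-1 : ℤ) : ℚ) + ((0 : ℤ) : ℚ) / 2, ((0 : ℤ) : ℚ) / 2, ((0 : ℤ) : ℚ) / 2⟩ : ℍ[ℚ,-1,-7]) =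
      ⟨((-A + B + D : ℤ) : ℚ) + ((-C - D : ℤ) : ℚ) / 2, ((-A - B - C : ℤ) : ℚ) + ((C - D : ℤ) : ℚ) / 2, ((-C - D : ℤ) : ℚ) / 2, ((C - D : ℤ) : ℚ) / 2⟩ := by
  ext <;> simp [QuaternionAlgebra.mk_mul_mk] <;> ring

/-- Right multiplication by an integer `u` scales the coordinates. [folklore] -/
private theorem mk_mul_intCast (A B C D u : ℤ) :
    (⟨(A : ℚ) + (C : ℚ) / 2, (B : ℚ) + (D : ℚ) / 2, (C : ℚ) / 2, (D : ℚ) / 2⟩ : ℍ[ℚ,-1,-7]) *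
        (⟨((u : ℤ) : ℚ) + ((0 : ℤ) : ℚ) / 2, ((0 : ℤ) : ℚ) + ((0 : ℤ) : ℚ) / 2, ((0 : ℤ) : ℚ) / 2, ((0 : ℤ) : ℚ) / 2⟩ : ℍ[ℚ,-1,-7]) =
      ⟨((u * A : ℤ) : ℚ) + ((u * C : ℤ) : ℚ) / 2, ((u * B : ℤ) : ℚ) + ((u * D : ℤ) : ℚ) / 2, ((u * C : ℤ) : ℚ) / 2,
        ((u * D : ℤ) : ℚ) / 2⟩ := by
  ext <;> simp [QuaternionAlgebra.mk_mul_mk] <;> ring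

/-- The centred residue `((L + h) mod n) − h` is congruent to `L` mod `n`. [folklore] -/
private theorem centred_modEq (L h n : ℤ) : ((L + h) % n - h) ≡ L [ZMOD n] := by
  have h1 : (L + h) % n ≡ L + h [ZMOD n] := Int.mod_modEq _ _
  have h2 := h1.sub_right h
  rwa [add_sub_cancel_right] at h2

/-- `O₇`-coordinates are additive: `mk(a) + n • mk(t) = mk(a + n t)`. [folklore] -/
private theorem mk_add_smul_mk (a₀ a₁ a₂ a₃ t₀ t₁ t₂ t₃ n : ℤ) :
    (⟨(a₀ : ℚ) + (a₂ : ℚ) / 2, (a₁ : ℚ) + (a₃ : ℚ) / 2, (a₂ : ℚ) / 2, (a₃ : ℚ) / 2⟩ : ℍ[ℚ,-1,-7]) +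
        (n : ℚ) • (⟨(t₀ : ℚ) + (t₂ : ℚ) / 2, (t₁ : ℚ) + (t₃ : ℚ) / 2, (t₂ : ℚ) / 2, (t₃ : ℚ) / 2⟩ : ℍ[ℚ,-1,-7]) =
      ⟨((a₀ + n * t₀ : ℤ) : ℚ) + ((a₂ + n * t₂ : ℤ) : ℚ) / 2, ((a₁ + n * t₁ : ℤ) : ℚ) + ((a₃ + n * t₃ : ℤ) : ℚ) / 2,
        ((a₂ + n * t₂ : ℤ) : ℚ) / 2, ((a₃ + n * t₃ : ℤ) : ℚ) / 2⟩ := by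
  ext <;> simp <;> ring

/-- **THE REDUCTION STEP.** Let `x, α ∈ O₇` with `xα = P₀ + P₁i + P₂ω + P₃iω`, `p ≥ 1`, and `c ∈ ℤ⁴` with `cᵢ ≡ Pᵢ (mod p)` and
`0 < Q₇(c) < p²`. Then `β := (xα − c)/p ∈ O₇` satisfies `0 < nrd((x/p)α − β) = Q₇(c)/p² < 1`. [cite: CardosoMachiavelo2025, Prop. 3 and Thm. 7 (β by rounding the coordinates of αρ)] -/
theorem exists_beta {p : ℕ} (hp : 0 < p) {x α : ℍ[ℚ,-1,-7]} (hα : α ∈ (Submodule.span ℤ (Set.range ![(⟨1, 0, 0, 0⟩ : ℍ[ℚ,-1,-7]), ⟨0, 1, 0, 0⟩, ⟨1/2, 0, 1/2, 0⟩, ⟨0, 1/2, 0, 1/2⟩]))) {P₀ P₁ P₂ P₃ c₀ c₁ c₂ c₃ : ℤ}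
    (hx : x * α = ⟨(P₀ : ℚ) + (P₂ : ℚ) / 2, (P₁ : ℚ) + (P₃ : ℚ) / 2, (P₂ : ℚ) / 2, (P₃ : ℚ) / 2⟩)
    (h₀ : c₀ ≡ P₀ [ZMOD (p : ℤ)]) (h₁ : c₁ ≡ P₁ [ZMOD (p : ℤ)]) (h₂ : c₂ ≡ P₂ [ZMOD (p : ℤ)]) (h₃ : c₃ ≡ P₃ [ZMOD (p : ℤ)])
    (hpos : 0 < c₀ ^ 2 + c₀ * c₂ + 2 * c₂ ^ 2 + c₁ ^ 2 + c₁ * c₃ + 2 * c₃ ^ 2)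
    (hlt : c₀ ^ 2 + c₀ * c₂ + 2 * c₂ ^ 2 + c₁ ^ 2 + c₁ * c₃ + 2 * c₃ ^ 2 < (p : ℤ) ^ 2) :
    ∃ β ∈ (Submodule.span ℤ (Set.range ![(⟨1, 0, 0, 0⟩ : ℍ[ℚ,-1,-7]), ⟨0, 1, 0, 0⟩, ⟨1/2, 0, 1/2, 0⟩, ⟨0, 1/2, 0, 1/2⟩])), 0 < reducedNorm ℚ ℍ[ℚ,-1,-7] (((p : ℚ)⁻¹ • x) * α - β) ∧ reducedNorm ℚ ℍ[ℚ,-1,-7] (((p : ℚ)⁻¹ • x) * α - β) < 1 := by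
  haveI := isQuaternionAlgebra
  have _ := hα
  obtain ⟨e₀, he₀⟩ := Int.ModEq.dvd h₀
  obtain ⟨e₁, he₁⟩ := Int.ModEq.dvd h₁
  obtain ⟨e₂, he₂⟩ := Int.ModEq.dvd h₂
  obtain ⟨e₃, he₃⟩ := Int.ModEq.dvd h₃
  have hp' : (p : ℚ) ≠ 0 := by exact_mod_cast hp.ne'
  have hP₀ : (P₀ : ℚ) = c₀ + (p : ℚ) * e₀ := by
    have h := congrArg (fun z : ℤ => (z : ℚ)) he₀; push_cast at h; linarith
  have hP₁ : (P₁ : ℚ) = c₁ + (p : ℚ) * e₁ := by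
    have h := congrArg (fun z : ℤ => (z : ℚ)) he₁; push_cast at h; linarith
  have hP₂ : (P₂ : ℚ) = c₂ + (p : ℚ) * e₂ := by
    have h := congrArg (fun z : ℤ => (z : ℚ)) he₂; push_cast at h; linarith
  have hP₃ : (P₃ : ℚ) = c₃ + (p : ℚ) * e₃ := by
    have h := congrArg (fun z : ℤ => (z : ℚ)) he₃; push_cast at h; linarith
  refine ⟨⟨(e₀ : ℚ) + (e₂ : ℚ) / 2, (e₁ : ℚ) + (e₃ : ℚ) / 2, (e₂ : ℚ) / 2, (e₃ : ℚ) / 2⟩, mk_mem_lattice e₀ e₁ e₂ e₃, ?_⟩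
  have key : ((p : ℚ)⁻¹ • x) * α - ⟨(e₀ : ℚ) + (e₂ : ℚ) / 2, (e₁ : ℚ) + (e₃ : ℚ) / 2, (e₂ : ℚ) / 2, (e₃ : ℚ) / 2⟩ =
      (p : ℚ)⁻¹ • (⟨(c₀ : ℚ) + (c₂ : ℚ) / 2, (c₁ : ℚ) + (c₃ : ℚ) / 2, (c₂ : ℚ) / 2, (c₃ : ℚ) / 2⟩ : ℍ[ℚ,-1,-7]) := by
    rw [smul_mul_assoc, hx]
    ext <;> simp [hP₀, hP₁, hP₂, hP₃] <;> field_simp <;> ring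
  rw [key, reducedNorm_smul, reducedNorm_mk]
  have hq : (0 : ℚ) < (p : ℚ)⁻¹ ^ 2 := by positivity
  have hp2 : ((p : ℚ)⁻¹) ^ 2 * ((p : ℤ) ^ 2 : ℤ) = 1 := by push_cast; field_simp
  constructor
  · have h : (0 : ℚ) < ((c₀ ^ 2 + c₀ * c₂ + 2 * c₂ ^ 2 + c₁ ^ 2 + c₁ * c₃ + 2 * c₃ ^ 2 : ℤ) : ℚ) := by exact_mod_cast hpos
    positivity
  · have h : ((c₀ ^ 2 + c₀ * c₂ + 2 * c₂ ^ 2 + c₁ ^ 2 + c₁ * c₃ + 2 * c₃ ^ 2 : ℤ) : ℚ) < (((p : ℤ) ^ 2 : ℤ) : ℚ) := by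
      exact_mod_cast hlt
    calc (p : ℚ)⁻¹ ^ 2 * ((c₀ ^ 2 + c₀ * c₂ + 2 * c₂ ^ 2 + c₁ ^ 2 + c₁ * c₃ + 2 * c₃ ^ 2 : ℤ) : ℚ)
        < (p : ℚ)⁻¹ ^ 2 * (((p : ℤ) ^ 2 : ℤ) : ℚ) := mul_lt_mul_of_pos_left h hq
      _ = 1 := hp2

/-- Translation by `pO₇` does not change the problem: if `x = x' + p·y` with `y ∈ O₇`, multipliers for `x'/p` serve for `x/p`
(`β ↦ β + yα`). [cite: CardosoMachiavelo2025, Prop. 2 and Cor. 1] -/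
theorem exists_of_add_smul {p : ℕ} (hp : 0 < p) {x x' y : ℍ[ℚ,-1,-7]} (hy : y ∈ (Submodule.span ℤ (Set.range ![(⟨1, 0, 0, 0⟩ : ℍ[ℚ,-1,-7]), ⟨0, 1, 0, 0⟩, ⟨1/2, 0, 1/2, 0⟩, ⟨0, 1/2, 0, 1/2⟩]))) (e : x = x' + (p : ℚ) • y)
    (h : ∃ α ∈ (Submodule.span ℤ (Set.range ![(⟨1, 0, 0, 0⟩ : ℍ[ℚ,-1,-7]), ⟨0, 1, 0, 0⟩, ⟨1/2, 0, 1/2, 0⟩, ⟨0, 1/2, 0, 1/2⟩])), ∃ β ∈ (Submodule.span ℤ (Set.range ![(⟨1, 0, 0, 0⟩ : ℍ[ℚ,-1,-7]), ⟨0, 1, 0, 0⟩, ⟨1/2, 0, 1/2, 0⟩, ⟨0, 1/2, 0, 1/2⟩])),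
      0 < reducedNorm ℚ ℍ[ℚ,-1,-7] (((p : ℚ)⁻¹ • x') * α - β) ∧ reducedNorm ℚ ℍ[ℚ,-1,-7] (((p : ℚ)⁻¹ • x') * α - β) < 1) :
    ∃ α ∈ (Submodule.span ℤ (Set.range ![(⟨1, 0, 0, 0⟩ : ℍ[ℚ,-1,-7]), ⟨0, 1, 0, 0⟩, ⟨1/2, 0, 1/2, 0⟩, ⟨0, 1/2, 0, 1/2⟩])), ∃ β ∈ (Submodule.span ℤ (Set.range ![(⟨1, 0, 0, 0⟩ : ℍ[ℚ,-1,-7]), ⟨0, 1, 0, 0⟩, ⟨1/2, 0, 1/2, 0⟩, ⟨0, 1/2, 0, 1/2⟩])),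
      0 < reducedNorm ℚ ℍ[ℚ,-1,-7] (((p : ℚ)⁻¹ • x) * α - β) ∧ reducedNorm ℚ ℍ[ℚ,-1,-7] (((p : ℚ)⁻¹ • x) * α - β) < 1 := by
  obtain ⟨α, hα, β, hβ, h1, h2⟩ := h
  have hp' : (p : ℚ) ≠ 0 := by exact_mod_cast hp.ne'
  refine ⟨α, hα, β + y * α, ((Submodule.span ℤ (Set.range ![(⟨1, 0, 0, 0⟩ : ℍ[ℚ,-1,-7]), ⟨0, 1, 0, 0⟩, ⟨1/2, 0, 1/2, 0⟩, ⟨0, 1/2, 0, 1/2⟩]))).add_mem hβ (mul_mem_lattice hy hα), ?_⟩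
  have key : ((p : ℚ)⁻¹ • x) * α - (β + y * α) = ((p : ℚ)⁻¹ • x') * α - β := by
    rw [e, smul_add, smul_smul, inv_mul_cancel₀ hp', one_smul, add_mul]
    abel
  rw [key]
  exact ⟨h1, h2⟩

end Coordinates

/-! ## §2 The primes `p ≤ 13`: kernel-checked certificates -/

section Certificates

set_option synthInstance.maxHeartbeats 400000 in
set_option synthInstance.maxSize 4000 in
/-- **The Dedekind–Hasse certificates at `p = 2`**: for every `δ = d₀ + d₁i + d₂ω + d₃iω ∈ O₇ ∖ 2O₇` (residues
`0 ≤ dᵢ < 2`, not all `0`) one of the four multipliers `α ∈ {−i, −1, −iω, −1−i}` gives a centred lift `c` of the coordinates of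
`δα` mod `2` with `0 < Q₇(c) < 2²` (checked by the kernel, `decide`; cf. the PARI/GP verification of the source).
[cite: CardosoMachiavelo2025, Thm. 7 and §5.1 Thm. 8 (the finite check for H₁,₇ at p ≤ 13)] -/
private theorem cert_2 : ∀ d₀ < (2 : ℕ), ∀ d₁ < (2 : ℕ), ∀ d₂ < (2 : ℕ), ∀ d₃ < (2 : ℕ),
    (d₀ ≠ 0 ∨ d₁ ≠ 0 ∨ d₂ ≠ 0 ∨ d₃ ≠ 0) →
      (0 < ((((d₁ : ℤ) + (d₃ : ℤ)) + (0 : ℤ)) % ((2 : ℕ) : ℤ) - (0 : ℤ)) ^ 2 + ((((d₁ : ℤ) + (d₃ : ℤ)) + (0 : ℤ)) % ((2 : ℕ) : ℤ) - (0 : ℤ)) * (((-(d₃ : ℤ)) + (0 : ℤ)) % ((2 : ℕ) : ℤ) - (0 : ℤ)) + 2 * (((-(d₃ : ℤ)) + (0 : ℤ)) % ((2 : ℕ) : ℤ) - (0 : ℤ)) ^ 2 + (((-(d₀ : ℤ) - (d₂ : ℤ)) + (0 : ℤ)) % ((2 : ℕ) : ℤ) - (0 : ℤ)) ^ 2 +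 (((-(d₀ : ℤ) - (d₂ : ℤ)) + (0 : ℤ)) % ((2 : ℕ) : ℤ) - (0 : ℤ)) * ((((d₂ : ℤ)) + (0 : ℤ)) % ((2 : ℕ) : ℤ) - (0 : ℤ)) + 2 * ((((d₂ : ℤ)) + (0 : ℤ)) % ((2 : ℕ) : ℤ) - (0 : ℤ)) ^ 2 ∧
        ((((d₁ : ℤ) + (d₃ : ℤ)) + (0 : ℤ)) % ((2 : ℕ) : ℤ) - (0 : ℤ)) ^ 2 + ((((d₁ : ℤ) + (d₃ : ℤ)) + (0 : ℤ)) % ((2 : ℕ) : ℤ) - (0 : ℤ)) * (((-(d₃ : ℤ)) + (0 : ℤ)) % ((2 : ℕ) : ℤ) - (0 : ℤ)) + 2 * (((-(d₃ : ℤ)) + (0 : ℤ)) % ((2 : ℕ) : ℤ) - (0 : ℤ)) ^ 2 + (((-(d₀ : ℤ) - (d₂ : ℤ)) + (0 : ℤ)) % ((2 : ℕ) : ℤ) - (0 : ℤ)) ^ 2 + (((-(d₀ : ℤ) - (d₂ : ℤ)) + (0 : ℤ)) % ((2 : ℕ) : ℤ) - (0 : ℤ)) * ((((d₂ : ℤ))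 + (0 : ℤ)) % ((2 : ℕ) : ℤ) - (0 : ℤ)) + 2 * ((((d₂ : ℤ)) + (0 : ℤ)) % ((2 : ℕ) : ℤ) - (0 : ℤ)) ^ 2 < ((2 : ℕ) : ℤ) ^ 2) ∨
      (0 < (((-(d₀ : ℤ)) + (0 : ℤ)) % ((2 : ℕ) : ℤ) - (0 : ℤ)) ^ 2 + (((-(d₀ : ℤ)) + (0 : ℤ)) % ((2 : ℕ) : ℤ) - (0 : ℤ)) * (((-(d₂ : ℤ)) + (0 : ℤ)) % ((2 : ℕ) : ℤ) - (0 : ℤ)) + 2 * (((-(d₂ : ℤ)) + (0 : ℤ)) % ((2 : ℕ) : ℤ) - (0 : ℤ)) ^ 2 + (((-(d₁ : ℤ)) + (0 : ℤ)) % ((2 : ℕ) : ℤ) - (0 : ℤ)) ^ 2 + (((-(d₁ : ℤ)) + (0 : ℤ)) % ((2 : ℕ) : ℤ) - (0 : ℤ)) * (((-(d₃ : ℤ)) + (0 : ℤ)) % ((2 : ℕ) : ℤ) - (0 : ℤ)) + 2 * (((-(d₃ : ℤ)) + (0 : ℤ)) % ((2 : ℕ) : ℤ) - (0 : ℤ))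 ^ 2 ∧
        (((-(d₀ : ℤ)) + (0 : ℤ)) % ((2 : ℕ) : ℤ) - (0 : ℤ)) ^ 2 + (((-(d₀ : ℤ)) + (0 : ℤ)) % ((2 : ℕ) : ℤ) - (0 : ℤ)) * (((-(d₂ : ℤ)) + (0 : ℤ)) % ((2 : ℕ) : ℤ) - (0 : ℤ)) + 2 * (((-(d₂ : ℤ)) + (0 : ℤ)) % ((2 : ℕ) : ℤ) - (0 : ℤ)) ^ 2 + (((-(d₁ : ℤ)) + (0 : ℤ)) % ((2 : ℕ) : ℤ) - (0 : ℤ)) ^ 2 + (((-(d₁ : ℤ)) + (0 : ℤ)) % ((2 : ℕ) : ℤ) - (0 : ℤ)) * (((-(d₃ : ℤ)) + (0 : ℤ)) % ((2 : ℕ) : ℤ) - (0 : ℤ)) + 2 * (((-(d₃ : ℤ)) + (0 : ℤ)) % ((2 : ℕ) : ℤ) - (0 : ℤ)) ^ 2 < ((2 : ℕ) : ℤ) ^ 2) ∨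
      (0 < (((2 * (d₃ : ℤ)) + (0 : ℤ)) % ((2 : ℕ) : ℤ) - (0 : ℤ)) ^ 2 + (((2 * (d₃ : ℤ)) + (0 : ℤ)) % ((2 : ℕ) : ℤ) - (0 : ℤ)) * ((((d₁ : ℤ)) + (0 : ℤ)) % ((2 : ℕ) : ℤ) - (0 : ℤ)) + 2 * ((((d₁ : ℤ)) + (0 : ℤ)) % ((2 : ℕ) : ℤ) - (0 : ℤ)) ^ 2 + (((-2 * (d₂ : ℤ)) + (0 : ℤ)) % ((2 : ℕ) : ℤ) - (0 : ℤ)) ^ 2 + (((-2 * (d₂ : ℤ)) + (0 : ℤ)) % ((2 : ℕ) : ℤ) - (0 : ℤ)) * (((-(d₀ : ℤ)) + (0 : ℤ)) % ((2 : ℕ) : ℤ) - (0 : ℤ)) + 2 * (((-(d₀ : ℤ)) + (0 : ℤ)) % ((2 : ℕ) : ℤ) - (0 : ℤ)) ^ 2 ∧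
        (((2 * (d₃ : ℤ)) + (0 : ℤ)) % ((2 : ℕ) : ℤ) - (0 : ℤ)) ^ 2 + (((2 * (d₃ : ℤ)) + (0 : ℤ)) % ((2 : ℕ) : ℤ) - (0 : ℤ)) * ((((d₁ : ℤ)) + (0 : ℤ)) % ((2 : ℕ) : ℤ) - (0 : ℤ)) + 2 * ((((d₁ : ℤ)) + (0 : ℤ)) % ((2 : ℕ) : ℤ) - (0 : ℤ)) ^ 2 + (((-2 * (d₂ : ℤ)) + (0 : ℤ)) % ((2 : ℕ) : ℤ) - (0 : ℤ)) ^ 2 + (((-2 * (d₂ : ℤ)) + (0 : ℤ)) % ((2 : ℕ) : ℤ) - (0 : ℤ)) * (((-(d₀ : ℤ)) + (0 : ℤ)) % ((2 : ℕ) : ℤ) - (0 : ℤ)) + 2 * (((-(d₀ : ℤ)) + (0 : ℤ)) % ((2 : ℕ) : ℤ) - (0 : ℤ)) ^ 2 < ((2 : ℕ) : ℤ) ^ 2) ∨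
      (0 < (((-(d₀ : ℤ) + (d₁ : ℤ) + (d₃ : ℤ)) + (0 : ℤ)) % ((2 : ℕ) : ℤ) - (0 : ℤ)) ^ 2 + (((-(d₀ : ℤ) + (d₁ : ℤ) + (d₃ : ℤ)) + (0 : ℤ)) % ((2 : ℕ) : ℤ) - (0 : ℤ)) * (((-(d₂ : ℤ) - (d₃ : ℤ)) + (0 : ℤ)) % ((2 : ℕ) : ℤ) - (0 : ℤ)) + 2 * (((-(d₂ : ℤ) - (d₃ : ℤ)) + (0 : ℤ)) % ((2 : ℕ) : ℤ) - (0 : ℤ)) ^ 2 + (((-(d₀ : ℤ) - (d₁ : ℤ) - (d₂ : ℤ)) + (0 : ℤ)) % ((2 : ℕ) : ℤ) - (0 : ℤ)) ^ 2 + (((-(d₀ : ℤ) - (d₁ : ℤ) - (d₂ : ℤ)) + (0 : ℤ)) % ((2 : ℕ) : ℤ) - (0 : ℤ)) * ((((d₂ : ℤ) - (d₃ : ℤ)) + (0 : ℤ)) % ((2 : ℕ) : ℤ) - (0 : ℤ)) + 2 * ((((d₂ : ℤ) - (d₃ : ℤ)) + (0 : ℤ)) % ((2 : ℕ) : ℤ)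 - (0 : ℤ)) ^ 2 ∧
        (((-(d₀ : ℤ) + (d₁ : ℤ) + (d₃ : ℤ)) + (0 : ℤ)) % ((2 : ℕ) : ℤ) - (0 : ℤ)) ^ 2 + (((-(d₀ : ℤ) + (d₁ : ℤ) + (d₃ : ℤ)) + (0 : ℤ)) % ((2 : ℕ) : ℤ) - (0 : ℤ)) * (((-(d₂ : ℤ) - (d₃ : ℤ)) + (0 : ℤ)) % ((2 : ℕ) : ℤ) - (0 : ℤ)) + 2 * (((-(d₂ : ℤ) - (d₃ : ℤ)) + (0 : ℤ)) % ((2 : ℕ) : ℤ) - (0 : ℤ)) ^ 2 + (((-(d₀ : ℤ) - (d₁ : ℤ) - (d₂ : ℤ)) + (0 : ℤ)) % ((2 : ℕ) : ℤ) - (0 : ℤ)) ^ 2 + (((-(d₀ : ℤ) - (d₁ : ℤ) - (d₂ : ℤ)) + (0 : ℤ)) % ((2 : ℕ) : ℤ) - (0 : ℤ)) * ((((d₂ : ℤ) - (d₃ : ℤ)) + (0 : ℤ)) % ((2 : ℕ) : ℤ) - (0 : ℤ)) + 2 * ((((d₂ : ℤ) - (d₃ : ℤ)) + (0 : ℤ))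 % ((2 : ℕ) : ℤ) - (0 : ℤ)) ^ 2 < ((2 : ℕ) : ℤ) ^ 2) := by
  decide +kernel

set_option synthInstance.maxHeartbeats 400000 in
set_option synthInstance.maxSize 4000 in
/-- **The Dedekind–Hasse certificates at `p = 3`**: for every `δ = d₀ + d₁i + d₂ω + d₃iω ∈ O₇ ∖ 3O₇` (residues
`0 ≤ dᵢ < 3`, not all `0`) one of the four multipliers `α ∈ {−i, −1, −iω, −1−i}` gives a centred lift `c` of the coordinates of
`δα` mod `3` with `0 < Q₇(c) < 3²` (checked by the kernel, `decide`; cf. the PARI/GP verification of the source).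
[cite: CardosoMachiavelo2025, Thm. 7 and §5.1 Thm. 8 (the finite check for H₁,₇ at p ≤ 13)] -/
private theorem cert_3 : ∀ d₀ < (3 : ℕ), ∀ d₁ < (3 : ℕ), ∀ d₂ < (3 : ℕ), ∀ d₃ < (3 : ℕ),
    (d₀ ≠ 0 ∨ d₁ ≠ 0 ∨ d₂ ≠ 0 ∨ d₃ ≠ 0) →
      (0 < ((((d₁ : ℤ) + (d₃ : ℤ)) + (1 : ℤ)) % ((3 : ℕ) : ℤ) - (1 : ℤ)) ^ 2 + ((((d₁ : ℤ) + (d₃ : ℤ)) + (1 : ℤ)) % ((3 : ℕ) : ℤ) - (1 : ℤ)) * (((-(d₃ : ℤ)) + (1 : ℤ)) % ((3 : ℕ) : ℤ) - (1 : ℤ)) + 2 * (((-(d₃ : ℤ)) + (1 : ℤ)) % ((3 : ℕ) : ℤ) - (1 : ℤ)) ^ 2 + (((-(d₀ : ℤ) - (d₂ : ℤ)) + (1 : ℤ)) % ((3 : ℕ) : ℤ) - (1 : ℤ)) ^ 2 + (((-(d₀ : ℤ) - (d₂ : ℤ)) + (1 : ℤ)) % ((3 : ℕ) : ℤ) - (1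 : ℤ)) * ((((d₂ : ℤ)) + (1 : ℤ)) % ((3 : ℕ) : ℤ) - (1 : ℤ)) + 2 * ((((d₂ : ℤ)) + (1 : ℤ)) % ((3 : ℕ) : ℤ) - (1 : ℤ)) ^ 2 ∧
        ((((d₁ : ℤ) + (d₃ : ℤ)) + (1 : ℤ)) % ((3 : ℕ) : ℤ) - (1 : ℤ)) ^ 2 + ((((d₁ : ℤ) + (d₃ : ℤ)) + (1 : ℤ)) % ((3 : ℕ) : ℤ) - (1 : ℤ)) * (((-(d₃ : ℤ)) + (1 : ℤ)) % ((3 : ℕ) : ℤ) - (1 : ℤ)) + 2 * (((-(d₃ : ℤ)) + (1 : ℤ)) % ((3 : ℕ) : ℤ) - (1 : ℤ)) ^ 2 + (((-(d₀ : ℤ) - (d₂ : ℤ)) + (1 : ℤ)) % ((3 : ℕ) : ℤ) - (1 : ℤ)) ^ 2 + (((-(d₀ : ℤ) - (d₂ : ℤ)) + (1 : ℤ)) % ((3 : ℕ) : ℤ) - (1 : ℤ)) * ((((d₂ : ℤ)) + (1 : ℤ)) % ((3 : ℕ) : ℤ) - (1 : ℤ)) + 2 * ((((d₂ : ℤ))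 + (1 : ℤ)) % ((3 : ℕ) : ℤ) - (1 : ℤ)) ^ 2 < ((3 : ℕ) : ℤ) ^ 2) ∨
      (0 < (((-(d₀ : ℤ)) + (1 : ℤ)) % ((3 : ℕ) : ℤ) - (1 : ℤ)) ^ 2 + (((-(d₀ : ℤ)) + (1 : ℤ)) % ((3 : ℕ) : ℤ) - (1 : ℤ)) * (((-(d₂ : ℤ)) + (1 : ℤ)) % ((3 : ℕ) : ℤ) - (1 : ℤ)) + 2 * (((-(d₂ : ℤ)) + (1 : ℤ)) % ((3 : ℕ) : ℤ) - (1 : ℤ)) ^ 2 + (((-(d₁ : ℤ)) + (1 : ℤ)) % ((3 : ℕ) : ℤ) - (1 : ℤ)) ^ 2 + (((-(d₁ : ℤ)) + (1 : ℤ)) % ((3 : ℕ) : ℤ) - (1 : ℤ)) * (((-(d₃ : ℤ)) + (1 : ℤ)) % ((3 : ℕ) : ℤ) - (1 : ℤ)) + 2 * (((-(d₃ : ℤ)) + (1 : ℤ)) % ((3 : ℕ) : ℤ) - (1 : ℤ)) ^ 2 ∧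
        (((-(d₀ : ℤ)) + (1 : ℤ)) % ((3 : ℕ) : ℤ) - (1 : ℤ)) ^ 2 + (((-(d₀ : ℤ)) + (1 : ℤ)) % ((3 : ℕ) : ℤ) - (1 : ℤ)) * (((-(d₂ : ℤ)) + (1 : ℤ)) % ((3 : ℕ) : ℤ) - (1 : ℤ)) + 2 * (((-(d₂ : ℤ)) + (1 : ℤ)) % ((3 : ℕ) : ℤ) - (1 : ℤ)) ^ 2 + (((-(d₁ : ℤ)) + (1 : ℤ)) % ((3 : ℕ) : ℤ) - (1 : ℤ)) ^ 2 + (((-(d₁ : ℤ)) + (1 : ℤ)) % ((3 : ℕ) : ℤ) - (1 : ℤ)) * (((-(d₃ : ℤ)) + (1 : ℤ)) % ((3 : ℕ) : ℤ) - (1 : ℤ)) + 2 * (((-(d₃ : ℤ)) + (1 : ℤ)) % ((3 : ℕ) : ℤ) - (1 : ℤ)) ^ 2 < ((3 : ℕ) : ℤ) ^ 2) ∨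
      (0 < (((2 * (d₃ : ℤ)) + (1 : ℤ)) % ((3 : ℕ) : ℤ) - (1 : ℤ)) ^ 2 + (((2 * (d₃ : ℤ)) + (1 : ℤ)) % ((3 : ℕ) : ℤ) - (1 : ℤ)) * ((((d₁ : ℤ)) + (1 : ℤ)) % ((3 : ℕ) : ℤ) - (1 : ℤ)) + 2 * ((((d₁ : ℤ)) + (1 : ℤ)) % ((3 : ℕ) : ℤ) - (1 : ℤ)) ^ 2 + (((-2 * (d₂ : ℤ)) + (1 : ℤ)) % ((3 : ℕ) : ℤ) - (1 : ℤ)) ^ 2 + (((-2 * (d₂ : ℤ)) + (1 : ℤ)) % ((3 : ℕ) : ℤ) - (1 : ℤ)) * (((-(d₀ : ℤ)) + (1 : ℤ)) % ((3 : ℕ) : ℤ) - (1 : ℤ)) + 2 * (((-(d₀ : ℤ)) + (1 : ℤ)) % ((3 : ℕ) : ℤ) - (1 : ℤ)) ^ 2 ∧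
        (((2 * (d₃ : ℤ)) + (1 : ℤ)) % ((3 : ℕ) : ℤ) - (1 : ℤ)) ^ 2 + (((2 * (d₃ : ℤ)) + (1 : ℤ)) % ((3 : ℕ) : ℤ) - (1 : ℤ)) * ((((d₁ : ℤ)) + (1 : ℤ)) % ((3 : ℕ) : ℤ) - (1 : ℤ)) + 2 * ((((d₁ : ℤ)) + (1 : ℤ)) % ((3 : ℕ) : ℤ) - (1 : ℤ)) ^ 2 + (((-2 * (d₂ : ℤ)) + (1 : ℤ)) % ((3 : ℕ) : ℤ) - (1 : ℤ)) ^ 2 + (((-2 * (d₂ : ℤ)) + (1 : ℤ)) % ((3 : ℕ) : ℤ) - (1 : ℤ)) * (((-(d₀ : ℤ)) + (1 : ℤ)) % ((3 : ℕ) : ℤ) - (1 : ℤ)) + 2 * (((-(d₀ : ℤ)) + (1 : ℤ)) % ((3 : ℕ) : ℤ) - (1 : ℤ)) ^ 2 < ((3 : ℕ) : ℤ) ^ 2) ∨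
      (0 < (((-(d₀ : ℤ) + (d₁ : ℤ) + (d₃ : ℤ)) + (1 : ℤ)) % ((3 : ℕ) : ℤ) - (1 : ℤ)) ^ 2 + (((-(d₀ : ℤ) + (d₁ : ℤ) + (d₃ : ℤ)) + (1 : ℤ)) % ((3 : ℕ) : ℤ) - (1 : ℤ)) * (((-(d₂ : ℤ) - (d₃ : ℤ)) + (1 : ℤ)) % ((3 : ℕ) : ℤ) - (1 : ℤ)) + 2 * (((-(d₂ : ℤ) - (d₃ : ℤ)) + (1 : ℤ)) % ((3 : ℕ) : ℤ) - (1 : ℤ)) ^ 2 + (((-(d₀ : ℤ) - (d₁ : ℤ) - (d₂ : ℤ)) + (1 : ℤ)) % ((3 : ℕ) : ℤ) - (1 : ℤ)) ^ 2 + (((-(d₀ : ℤ) - (d₁ : ℤ) - (d₂ : ℤ)) + (1 : ℤ)) % ((3 : ℕ) : ℤ) - (1 : ℤ)) * ((((d₂ : ℤ) - (d₃ : ℤ)) + (1 : ℤ)) % ((3 : ℕ) : ℤ) - (1 : ℤ)) + 2 * ((((d₂ : ℤ) - (d₃ : ℤ)) + (1 : ℤ)) % ((3 : ℕ) : ℤ)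 - (1 : ℤ)) ^ 2 ∧
        (((-(d₀ : ℤ) + (d₁ : ℤ) + (d₃ : ℤ)) + (1 : ℤ)) % ((3 : ℕ) : ℤ) - (1 : ℤ)) ^ 2 + (((-(d₀ : ℤ) + (d₁ : ℤ) + (d₃ : ℤ)) + (1 : ℤ)) % ((3 : ℕ) : ℤ) - (1 : ℤ)) * (((-(d₂ : ℤ) - (d₃ : ℤ)) + (1 : ℤ)) % ((3 : ℕ) : ℤ) - (1 : ℤ)) + 2 * (((-(d₂ : ℤ) - (d₃ : ℤ)) + (1 : ℤ)) % ((3 : ℕ) : ℤ) - (1 : ℤ)) ^ 2 + (((-(d₀ : ℤ) - (d₁ : ℤ) - (d₂ : ℤ)) + (1 : ℤ)) % ((3 : ℕ) : ℤ) - (1 : ℤ)) ^ 2 + (((-(d₀ : ℤ) - (d₁ : ℤ) - (d₂ : ℤ)) + (1 : ℤ)) % ((3 : ℕ) : ℤ) - (1 : ℤ)) * ((((d₂ : ℤ) - (d₃ : ℤ)) + (1 : ℤ)) % ((3 : ℕ) : ℤ) - (1 : ℤ)) + 2 * ((((d₂ : ℤ) - (d₃ : ℤ)) + (1 : ℤ))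 % ((3 : ℕ) : ℤ) - (1 : ℤ)) ^ 2 < ((3 : ℕ) : ℤ) ^ 2) := by
  decide +kernel

set_option synthInstance.maxHeartbeats 400000 in
set_option synthInstance.maxSize 4000 in
/-- **The Dedekind–Hasse certificates at `p = 5`**: for every `δ = d₀ + d₁i + d₂ω + d₃iω ∈ O₇ ∖ 5O₇` (residues
`0 ≤ dᵢ < 5`, not all `0`) one of the four multipliers `α ∈ {−i, −1, −iω, −1−i}` gives a centred lift `c` of the coordinates of
`δα` mod `5` with `0 < Q₇(c) < 5²` (checked by the kernel, `decide`; cf. the PARI/GP verification of the source).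
[cite: CardosoMachiavelo2025, Thm. 7 and §5.1 Thm. 8 (the finite check for H₁,₇ at p ≤ 13)] -/
private theorem cert_5 : ∀ d₀ < (5 : ℕ), ∀ d₁ < (5 : ℕ), ∀ d₂ < (5 : ℕ), ∀ d₃ < (5 : ℕ),
    (d₀ ≠ 0 ∨ d₁ ≠ 0 ∨ d₂ ≠ 0 ∨ d₃ ≠ 0) →
      (0 < ((((d₁ : ℤ) + (d₃ : ℤ)) + (2 : ℤ)) % ((5 : ℕ) : ℤ) - (2 : ℤ)) ^ 2 + ((((d₁ : ℤ) + (d₃ : ℤ)) + (2 : ℤ)) % ((5 : ℕ) : ℤ) - (2 : ℤ)) * (((-(d₃ : ℤ)) + (2 : ℤ)) % ((5 : ℕ) : ℤ) - (2 : ℤ)) + 2 * (((-(d₃ : ℤ)) + (2 : ℤ)) % ((5 : ℕ) : ℤ) - (2 : ℤ)) ^ 2 + (((-(d₀ : ℤ) - (d₂ : ℤ)) + (2 : ℤ)) % ((5 : ℕ) : ℤ) - (2 : ℤ)) ^ 2 + (((-(d₀ : ℤ) - (d₂ : ℤ)) + (2 : ℤ)) % ((5 : ℕ) : ℤ) - (2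 : ℤ)) * ((((d₂ : ℤ)) + (2 : ℤ)) % ((5 : ℕ) : ℤ) - (2 : ℤ)) + 2 * ((((d₂ : ℤ)) + (2 : ℤ)) % ((5 : ℕ) : ℤ) - (2 : ℤ)) ^ 2 ∧
        ((((d₁ : ℤ) + (d₃ : ℤ)) + (2 : ℤ)) % ((5 : ℕ) : ℤ) - (2 : ℤ)) ^ 2 + ((((d₁ : ℤ) + (d₃ : ℤ)) + (2 : ℤ)) % ((5 : ℕ) : ℤ) - (2 : ℤ)) * (((-(d₃ : ℤ)) + (2 : ℤ)) % ((5 : ℕ) : ℤ) - (2 : ℤ)) + 2 * (((-(d₃ : ℤ)) + (2 : ℤ)) % ((5 : ℕ) : ℤ) - (2 : ℤ)) ^ 2 + (((-(d₀ : ℤ) - (d₂ : ℤ)) + (2 : ℤ)) % ((5 : ℕ) : ℤ) - (2 : ℤ)) ^ 2 + (((-(d₀ : ℤ) - (d₂ : ℤ)) + (2 : ℤ)) % ((5 : ℕ) : ℤ) - (2 : ℤ)) * ((((d₂ : ℤ)) + (2 : ℤ)) % ((5 : ℕ) : ℤ) - (2 : ℤ)) + 2 * ((((d₂ : ℤ))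 + (2 : ℤ)) % ((5 : ℕ) : ℤ) - (2 : ℤ)) ^ 2 < ((5 : ℕ) : ℤ) ^ 2) ∨
      (0 < (((-(d₀ : ℤ)) + (2 : ℤ)) % ((5 : ℕ) : ℤ) - (2 : ℤ)) ^ 2 + (((-(d₀ : ℤ)) + (2 : ℤ)) % ((5 : ℕ) : ℤ) - (2 : ℤ)) * (((-(d₂ : ℤ)) + (2 : ℤ)) % ((5 : ℕ) : ℤ) - (2 : ℤ)) + 2 * (((-(d₂ : ℤ)) + (2 : ℤ)) % ((5 : ℕ) : ℤ) - (2 : ℤ)) ^ 2 + (((-(d₁ : ℤ)) + (2 : ℤ)) % ((5 : ℕ) : ℤ) - (2 : ℤ)) ^ 2 + (((-(d₁ : ℤ)) + (2 : ℤ)) % ((5 : ℕ) : ℤ) - (2 : ℤ)) * (((-(d₃ : ℤ)) + (2 : ℤ)) % ((5 : ℕ) : ℤ) - (2 : ℤ)) + 2 * (((-(d₃ : ℤ)) + (2 : ℤ)) % ((5 : ℕ) : ℤ) - (2 : ℤ)) ^ 2 ∧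
        (((-(d₀ : ℤ)) + (2 : ℤ)) % ((5 : ℕ) : ℤ) - (2 : ℤ)) ^ 2 + (((-(d₀ : ℤ)) + (2 : ℤ)) % ((5 : ℕ) : ℤ) - (2 : ℤ)) * (((-(d₂ : ℤ)) + (2 : ℤ)) % ((5 : ℕ) : ℤ) - (2 : ℤ)) + 2 * (((-(d₂ : ℤ)) + (2 : ℤ)) % ((5 : ℕ) : ℤ) - (2 : ℤ)) ^ 2 + (((-(d₁ : ℤ)) + (2 : ℤ)) % ((5 : ℕ) : ℤ) - (2 : ℤ)) ^ 2 + (((-(d₁ : ℤ)) + (2 : ℤ)) % ((5 : ℕ) : ℤ) - (2 : ℤ)) * (((-(d₃ : ℤ)) + (2 : ℤ)) % ((5 : ℕ) : ℤ) - (2 : ℤ)) + 2 * (((-(d₃ : ℤ)) + (2 : ℤ)) % ((5 : ℕ) : ℤ) - (2 : ℤ)) ^ 2 < ((5 : ℕ) : ℤ) ^ 2) ∨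
      (0 < (((2 * (d₃ : ℤ)) + (2 : ℤ)) % ((5 : ℕ) : ℤ) - (2 : ℤ)) ^ 2 + (((2 * (d₃ : ℤ)) + (2 : ℤ)) % ((5 : ℕ) : ℤ) - (2 : ℤ)) * ((((d₁ : ℤ)) + (2 : ℤ)) % ((5 : ℕ) : ℤ) - (2 : ℤ)) + 2 * ((((d₁ : ℤ)) + (2 : ℤ)) % ((5 : ℕ) : ℤ) - (2 : ℤ)) ^ 2 + (((-2 * (d₂ : ℤ)) + (2 : ℤ)) % ((5 : ℕ) : ℤ) - (2 : ℤ)) ^ 2 + (((-2 * (d₂ : ℤ)) + (2 : ℤ)) % ((5 : ℕ) : ℤ) - (2 : ℤ)) * (((-(d₀ : ℤ)) + (2 : ℤ)) % ((5 : ℕ) : ℤ) - (2 : ℤ)) + 2 * (((-(d₀ : ℤ)) + (2 : ℤ)) % ((5 : ℕ) : ℤ) - (2 : ℤ)) ^ 2 ∧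
        (((2 * (d₃ : ℤ)) + (2 : ℤ)) % ((5 : ℕ) : ℤ) - (2 : ℤ)) ^ 2 + (((2 * (d₃ : ℤ)) + (2 : ℤ)) % ((5 : ℕ) : ℤ) - (2 : ℤ)) * ((((d₁ : ℤ)) + (2 : ℤ)) % ((5 : ℕ) : ℤ) - (2 : ℤ)) + 2 * ((((d₁ : ℤ)) + (2 : ℤ)) % ((5 : ℕ) : ℤ) - (2 : ℤ)) ^ 2 + (((-2 * (d₂ : ℤ)) + (2 : ℤ)) % ((5 : ℕ) : ℤ) - (2 : ℤ)) ^ 2 + (((-2 * (d₂ : ℤ)) + (2 : ℤ)) % ((5 : ℕ) : ℤ) - (2 : ℤ)) * (((-(d₀ : ℤ)) + (2 : ℤ)) % ((5 : ℕ) : ℤ) - (2 : ℤ)) + 2 * (((-(d₀ : ℤ)) + (2 : ℤ)) % ((5 : ℕ) : ℤ) - (2 : ℤ)) ^ 2 < ((5 : ℕ) : ℤ) ^ 2) ∨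
      (0 < (((-(d₀ : ℤ) + (d₁ : ℤ) + (d₃ : ℤ)) + (2 : ℤ)) % ((5 : ℕ) : ℤ) - (2 : ℤ)) ^ 2 + (((-(d₀ : ℤ) + (d₁ : ℤ) + (d₃ : ℤ)) + (2 : ℤ)) % ((5 : ℕ) : ℤ) - (2 : ℤ)) * (((-(d₂ : ℤ) - (d₃ : ℤ)) + (2 : ℤ)) % ((5 : ℕ) : ℤ) - (2 : ℤ)) + 2 * (((-(d₂ : ℤ) - (d₃ : ℤ)) + (2 : ℤ)) % ((5 : ℕ) : ℤ) - (2 : ℤ)) ^ 2 + (((-(d₀ : ℤ) - (d₁ : ℤ) - (d₂ : ℤ)) + (2 : ℤ)) % ((5 : ℕ) : ℤ) - (2 : ℤ)) ^ 2 + (((-(d₀ : ℤ) - (d₁ : ℤ) - (d₂ : ℤ)) + (2 : ℤ)) % ((5 : ℕ) : ℤ) - (2 : ℤ)) * ((((d₂ : ℤ) - (d₃ : ℤ)) + (2 : ℤ)) % ((5 : ℕ) : ℤ) - (2 : ℤ)) + 2 * ((((d₂ : ℤ) - (d₃ : ℤ)) + (2 : ℤ)) % ((5 : ℕ) : ℤ)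 - (2 : ℤ)) ^ 2 ∧
        (((-(d₀ : ℤ) + (d₁ : ℤ) + (d₃ : ℤ)) + (2 : ℤ)) % ((5 : ℕ) : ℤ) - (2 : ℤ)) ^ 2 + (((-(d₀ : ℤ) + (d₁ : ℤ) + (d₃ : ℤ)) + (2 : ℤ)) % ((5 : ℕ) : ℤ) - (2 : ℤ)) * (((-(d₂ : ℤ) - (d₃ : ℤ)) + (2 : ℤ)) % ((5 : ℕ) : ℤ) - (2 : ℤ)) + 2 * (((-(d₂ : ℤ) - (d₃ : ℤ)) + (2 : ℤ)) % ((5 : ℕ) : ℤ) - (2 : ℤ)) ^ 2 + (((-(d₀ : ℤ) - (d₁ : ℤ) - (d₂ : ℤ)) + (2 : ℤ)) % ((5 : ℕ) : ℤ) - (2 : ℤ)) ^ 2 + (((-(d₀ : ℤ) - (d₁ : ℤ) - (d₂ : ℤ)) + (2 : ℤ)) % ((5 : ℕ) : ℤ) - (2 : ℤ)) * ((((d₂ : ℤ) - (d₃ : ℤ)) + (2 : ℤ)) % ((5 : ℕ) : ℤ) - (2 : ℤ)) + 2 * ((((d₂ : ℤ) - (d₃ : ℤ)) + (2 : ℤ))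 % ((5 : ℕ) : ℤ) - (2 : ℤ)) ^ 2 < ((5 : ℕ) : ℤ) ^ 2) := by
  decide +kernel

set_option synthInstance.maxHeartbeats 400000 in
set_option synthInstance.maxSize 4000 in
/-- **The Dedekind–Hasse certificates at `p = 7`**: for every `δ = d₀ + d₁i + d₂ω + d₃iω ∈ O₇ ∖ 7O₇` (residues
`0 ≤ dᵢ < 7`, not all `0`) one of the four multipliers `α ∈ {−i, −1, −iω, −1−i}` gives a centred lift `c` of the coordinates of
`δα` mod `7` with `0 < Q₇(c) < 7²` (checked by the kernel, `decide`; cf. the PARI/GP verification of the source).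
[cite: CardosoMachiavelo2025, Thm. 7 and §5.1 Thm. 8 (the finite check for H₁,₇ at p ≤ 13)] -/
private theorem cert_7 : ∀ d₀ < (7 : ℕ), ∀ d₁ < (7 : ℕ), ∀ d₂ < (7 : ℕ), ∀ d₃ < (7 : ℕ),
    (d₀ ≠ 0 ∨ d₁ ≠ 0 ∨ d₂ ≠ 0 ∨ d₃ ≠ 0) →
      (0 < ((((d₁ : ℤ) + (d₃ : ℤ)) + (3 : ℤ)) % ((7 : ℕ) : ℤ) - (3 : ℤ)) ^ 2 + ((((d₁ : ℤ) + (d₃ : ℤ)) + (3 : ℤ)) % ((7 : ℕ) : ℤ) - (3 : ℤ)) * (((-(d₃ : ℤ)) + (3 : ℤ)) % ((7 : ℕ) : ℤ) - (3 : ℤ)) + 2 * (((-(d₃ : ℤ)) + (3 : ℤ)) % ((7 : ℕ) : ℤ) - (3 : ℤ)) ^ 2 + (((-(d₀ : ℤ) - (d₂ : ℤ)) + (3 : ℤ)) % ((7 : ℕ) : ℤ) - (3 : ℤ)) ^ 2 + (((-(d₀ : ℤ) - (d₂ : ℤ)) + (3 : ℤ)) % ((7 : ℕ) : ℤ) - (3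 : ℤ)) * ((((d₂ : ℤ)) + (3 : ℤ)) % ((7 : ℕ) : ℤ) - (3 : ℤ)) + 2 * ((((d₂ : ℤ)) + (3 : ℤ)) % ((7 : ℕ) : ℤ) - (3 : ℤ)) ^ 2 ∧
        ((((d₁ : ℤ) + (d₃ : ℤ)) + (3 : ℤ)) % ((7 : ℕ) : ℤ) - (3 : ℤ)) ^ 2 + ((((d₁ : ℤ) + (d₃ : ℤ)) + (3 : ℤ)) % ((7 : ℕ) : ℤ) - (3 : ℤ)) * (((-(d₃ : ℤ)) + (3 : ℤ)) % ((7 : ℕ) : ℤ) - (3 : ℤ)) + 2 * (((-(d₃ : ℤ)) + (3 : ℤ)) % ((7 : ℕ) : ℤ) - (3 : ℤ)) ^ 2 + (((-(d₀ : ℤ) - (d₂ : ℤ)) + (3 : ℤ)) % ((7 : ℕ) : ℤ) - (3 : ℤ)) ^ 2 + (((-(d₀ : ℤ) - (d₂ : ℤ)) + (3 : ℤ)) % ((7 : ℕ) : ℤ) - (3 : ℤ)) * ((((d₂ : ℤ)) + (3 : ℤ)) % ((7 : ℕ) : ℤ) - (3 : ℤ)) + 2 * ((((d₂ : ℤ))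 + (3 : ℤ)) % ((7 : ℕ) : ℤ) - (3 : ℤ)) ^ 2 < ((7 : ℕ) : ℤ) ^ 2) ∨
      (0 < (((-(d₀ : ℤ)) + (3 : ℤ)) % ((7 : ℕ) : ℤ) - (3 : ℤ)) ^ 2 + (((-(d₀ : ℤ)) + (3 : ℤ)) % ((7 : ℕ) : ℤ) - (3 : ℤ)) * (((-(d₂ : ℤ)) + (3 : ℤ)) % ((7 : ℕ) : ℤ) - (3 : ℤ)) + 2 * (((-(d₂ : ℤ)) + (3 : ℤ)) % ((7 : ℕ) : ℤ) - (3 : ℤ)) ^ 2 + (((-(d₁ : ℤ)) + (3 : ℤ)) % ((7 : ℕ) : ℤ) - (3 : ℤ)) ^ 2 + (((-(d₁ : ℤ)) + (3 : ℤ)) % ((7 : ℕ) : ℤ) - (3 : ℤ)) * (((-(d₃ : ℤ)) + (3 : ℤ)) % ((7 : ℕ) : ℤ) - (3 : ℤ)) + 2 * (((-(d₃ : ℤ)) + (3 : ℤ)) % ((7 : ℕ) : ℤ) - (3 : ℤ)) ^ 2 ∧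
        (((-(d₀ : ℤ)) + (3 : ℤ)) % ((7 : ℕ) : ℤ) - (3 : ℤ)) ^ 2 + (((-(d₀ : ℤ)) + (3 : ℤ)) % ((7 : ℕ) : ℤ) - (3 : ℤ)) * (((-(d₂ : ℤ)) + (3 : ℤ)) % ((7 : ℕ) : ℤ) - (3 : ℤ)) + 2 * (((-(d₂ : ℤ)) + (3 : ℤ)) % ((7 : ℕ) : ℤ) - (3 : ℤ)) ^ 2 + (((-(d₁ : ℤ)) + (3 : ℤ)) % ((7 : ℕ) : ℤ) - (3 : ℤ)) ^ 2 + (((-(d₁ : ℤ)) + (3 : ℤ)) % ((7 : ℕ) : ℤ) - (3 : ℤ)) * (((-(d₃ : ℤ)) + (3 : ℤ)) % ((7 : ℕ) : ℤ) - (3 : ℤ)) + 2 * (((-(d₃ : ℤ)) + (3 : ℤ)) % ((7 : ℕ) : ℤ) - (3 : ℤ)) ^ 2 < ((7 : ℕ) : ℤ) ^ 2) ∨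
      (0 < (((2 * (d₃ : ℤ)) + (3 : ℤ)) % ((7 : ℕ) : ℤ) - (3 : ℤ)) ^ 2 + (((2 * (d₃ : ℤ)) + (3 : ℤ)) % ((7 : ℕ) : ℤ) - (3 : ℤ)) * ((((d₁ : ℤ)) + (3 : ℤ)) % ((7 : ℕ) : ℤ) - (3 : ℤ)) + 2 * ((((d₁ : ℤ)) + (3 : ℤ)) % ((7 : ℕ) : ℤ) - (3 : ℤ)) ^ 2 + (((-2 * (d₂ : ℤ)) + (3 : ℤ)) % ((7 : ℕ) : ℤ) - (3 : ℤ)) ^ 2 + (((-2 * (d₂ : ℤ)) + (3 : ℤ)) % ((7 : ℕ) : ℤ) - (3 : ℤ)) * (((-(d₀ : ℤ)) + (3 : ℤ)) % ((7 : ℕ) : ℤ) - (3 : ℤ)) + 2 * (((-(d₀ : ℤ)) + (3 : ℤ)) % ((7 : ℕ) : ℤ) - (3 : ℤ)) ^ 2 ∧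
        (((2 * (d₃ : ℤ)) + (3 : ℤ)) % ((7 : ℕ) : ℤ) - (3 : ℤ)) ^ 2 + (((2 * (d₃ : ℤ)) + (3 : ℤ)) % ((7 : ℕ) : ℤ) - (3 : ℤ)) * ((((d₁ : ℤ)) + (3 : ℤ)) % ((7 : ℕ) : ℤ) - (3 : ℤ)) + 2 * ((((d₁ : ℤ)) + (3 : ℤ)) % ((7 : ℕ) : ℤ) - (3 : ℤ)) ^ 2 + (((-2 * (d₂ : ℤ)) + (3 : ℤ)) % ((7 : ℕ) : ℤ) - (3 : ℤ)) ^ 2 + (((-2 * (d₂ : ℤ)) + (3 : ℤ)) % ((7 : ℕ) : ℤ) - (3 : ℤ)) * (((-(d₀ : ℤ)) + (3 : ℤ)) % ((7 : ℕ) : ℤ) - (3 : ℤ)) + 2 * (((-(d₀ : ℤ)) + (3 : ℤ)) % ((7 : ℕ) : ℤ) - (3 : ℤ)) ^ 2 < ((7 : ℕ) : ℤ) ^ 2) ∨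
      (0 < (((-(d₀ : ℤ) + (d₁ : ℤ) + (d₃ : ℤ)) + (3 : ℤ)) % ((7 : ℕ) : ℤ) - (3 : ℤ)) ^ 2 + (((-(d₀ : ℤ) + (d₁ : ℤ) + (d₃ : ℤ)) + (3 : ℤ)) % ((7 : ℕ) : ℤ) - (3 : ℤ)) * (((-(d₂ : ℤ) - (d₃ : ℤ)) + (3 : ℤ)) % ((7 : ℕ) : ℤ) - (3 : ℤ)) + 2 * (((-(d₂ : ℤ) - (d₃ : ℤ)) + (3 : ℤ)) % ((7 : ℕ) : ℤ) - (3 : ℤ)) ^ 2 + (((-(d₀ : ℤ) - (d₁ : ℤ) - (d₂ : ℤ)) + (3 : ℤ)) % ((7 : ℕ) : ℤ) - (3 : ℤ)) ^ 2 + (((-(d₀ : ℤ) - (d₁ : ℤ) - (d₂ : ℤ)) + (3 : ℤ)) % ((7 : ℕ) : ℤ) - (3 : ℤ)) * ((((d₂ : ℤ) - (d₃ : ℤ)) + (3 : ℤ)) % ((7 : ℕ) : ℤ) - (3 : ℤ)) + 2 * ((((d₂ : ℤ) - (d₃ : ℤ)) + (3 : ℤ)) % ((7 : ℕ) : ℤ)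 - (3 : ℤ)) ^ 2 ∧
        (((-(d₀ : ℤ) + (d₁ : ℤ) + (d₃ : ℤ)) + (3 : ℤ)) % ((7 : ℕ) : ℤ) - (3 : ℤ)) ^ 2 + (((-(d₀ : ℤ) + (d₁ : ℤ) + (d₃ : ℤ)) + (3 : ℤ)) % ((7 : ℕ) : ℤ) - (3 : ℤ)) * (((-(d₂ : ℤ) - (d₃ : ℤ)) + (3 : ℤ)) % ((7 : ℕ) : ℤ) - (3 : ℤ)) + 2 * (((-(d₂ : ℤ) - (d₃ : ℤ)) + (3 : ℤ)) % ((7 : ℕ) : ℤ) - (3 : ℤ)) ^ 2 + (((-(d₀ : ℤ) - (d₁ : ℤ) - (d₂ : ℤ)) + (3 : ℤ)) % ((7 : ℕ) : ℤ) - (3 : ℤ)) ^ 2 + (((-(d₀ : ℤ) - (d₁ : ℤ) - (d₂ : ℤ)) + (3 : ℤ)) % ((7 : ℕ) : ℤ) - (3 : ℤ)) * ((((d₂ : ℤ) - (d₃ : ℤ)) + (3 : ℤ)) % ((7 : ℕ) : ℤ) - (3 : ℤ)) + 2 * ((((d₂ : ℤ) - (d₃ : ℤ)) + (3 : ℤ))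 % ((7 : ℕ) : ℤ) - (3 : ℤ)) ^ 2 < ((7 : ℕ) : ℤ) ^ 2) := by
  decide +kernel

set_option synthInstance.maxHeartbeats 400000 in
set_option synthInstance.maxSize 4000 in
/-- **The Dedekind–Hasse certificates at `p = 11`**: for every `δ = d₀ + d₁i + d₂ω + d₃iω ∈ O₇ ∖ 11O₇` (residues
`0 ≤ dᵢ < 11`, not all `0`) one of the four multipliers `α ∈ {−i, −1, −iω, −1−i}` gives a centred lift `c` of the coordinates of
`δα` mod `11` with `0 < Q₇(c) < 11²` (checked by the kernel, `decide`; cf. the PARI/GP verification of the source).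
[cite: CardosoMachiavelo2025, Thm. 7 and §5.1 Thm. 8 (the finite check for H₁,₇ at p ≤ 13)] -/
private theorem cert_11 : ∀ d₀ < (11 : ℕ), ∀ d₁ < (11 : ℕ), ∀ d₂ < (11 : ℕ), ∀ d₃ < (11 : ℕ),
    (d₀ ≠ 0 ∨ d₁ ≠ 0 ∨ d₂ ≠ 0 ∨ d₃ ≠ 0) →
      (0 < ((((d₁ : ℤ) + (d₃ : ℤ)) + (5 : ℤ)) % ((11 : ℕ) : ℤ) - (5 : ℤ)) ^ 2 + ((((d₁ : ℤ) + (d₃ : ℤ)) + (5 : ℤ)) % ((11 : ℕ) : ℤ) - (5 : ℤ)) * (((-(d₃ : ℤ)) + (5 : ℤ)) % ((11 : ℕ) : ℤ) - (5 : ℤ)) + 2 * (((-(d₃ : ℤ)) + (5 : ℤ)) % ((11 : ℕ) : ℤ) - (5 : ℤ)) ^ 2 + (((-(d₀ : ℤ) - (d₂ : ℤ)) + (5 : ℤ)) % ((11 : ℕ) : ℤ) - (5 : ℤ)) ^ 2 + (((-(d₀ : ℤ) - (d₂ : ℤ)) + (5 : ℤ)) % ((11 : ℕ) : ℤ) - (5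 : ℤ)) * ((((d₂ : ℤ)) + (5 : ℤ)) % ((11 : ℕ) : ℤ) - (5 : ℤ)) + 2 * ((((d₂ : ℤ)) + (5 : ℤ)) % ((11 : ℕ) : ℤ) - (5 : ℤ)) ^ 2 ∧
        ((((d₁ : ℤ) + (d₃ : ℤ)) + (5 : ℤ)) % ((11 : ℕ) : ℤ) - (5 : ℤ)) ^ 2 + ((((d₁ : ℤ) + (d₃ : ℤ)) + (5 : ℤ)) % ((11 : ℕ) : ℤ) - (5 : ℤ)) * (((-(d₃ : ℤ)) + (5 : ℤ)) % ((11 : ℕ) : ℤ) - (5 : ℤ)) + 2 * (((-(d₃ : ℤ)) + (5 : ℤ)) % ((11 : ℕ) : ℤ) - (5 : ℤ)) ^ 2 + (((-(d₀ : ℤ) - (d₂ : ℤ)) + (5 : ℤ)) % ((11 : ℕ) : ℤ) - (5 : ℤ)) ^ 2 + (((-(d₀ : ℤ) - (d₂ : ℤ)) + (5 : ℤ)) % ((11 : ℕ) : ℤ) - (5 : ℤ)) * ((((d₂ : ℤ)) + (5 : ℤ)) % ((11 : ℕ) : ℤ) - (5 : ℤ)) + 2 * ((((d₂ : ℤ))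 + (5 : ℤ)) % ((11 : ℕ) : ℤ) - (5 : ℤ)) ^ 2 < ((11 : ℕ) : ℤ) ^ 2) ∨
      (0 < (((-(d₀ : ℤ)) + (5 : ℤ)) % ((11 : ℕ) : ℤ) - (5 : ℤ)) ^ 2 + (((-(d₀ : ℤ)) + (5 : ℤ)) % ((11 : ℕ) : ℤ) - (5 : ℤ)) * (((-(d₂ : ℤ)) + (5 : ℤ)) % ((11 : ℕ) : ℤ) - (5 : ℤ)) + 2 * (((-(d₂ : ℤ)) + (5 : ℤ)) % ((11 : ℕ) : ℤ) - (5 : ℤ)) ^ 2 + (((-(d₁ : ℤ)) + (5 : ℤ)) % ((11 : ℕ) : ℤ) - (5 : ℤ)) ^ 2 + (((-(d₁ : ℤ)) + (5 : ℤ)) % ((11 : ℕ) : ℤ) - (5 : ℤ)) * (((-(d₃ : ℤ)) + (5 : ℤ)) % ((11 : ℕ) : ℤ) - (5 : ℤ)) + 2 * (((-(d₃ : ℤ)) + (5 : ℤ)) % ((11 : ℕ) : ℤ) - (5 : ℤ)) ^ 2 ∧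
        (((-(d₀ : ℤ)) + (5 : ℤ)) % ((11 : ℕ) : ℤ) - (5 : ℤ)) ^ 2 + (((-(d₀ : ℤ)) + (5 : ℤ)) % ((11 : ℕ) : ℤ) - (5 : ℤ)) * (((-(d₂ : ℤ)) + (5 : ℤ)) % ((11 : ℕ) : ℤ) - (5 : ℤ)) + 2 * (((-(d₂ : ℤ)) + (5 : ℤ)) % ((11 : ℕ) : ℤ) - (5 : ℤ)) ^ 2 + (((-(d₁ : ℤ)) + (5 : ℤ)) % ((11 : ℕ) : ℤ) - (5 : ℤ)) ^ 2 + (((-(d₁ : ℤ)) + (5 : ℤ)) % ((11 : ℕ) : ℤ) - (5 : ℤ)) * (((-(d₃ : ℤ)) + (5 : ℤ)) % ((11 : ℕ) : ℤ) - (5 : ℤ)) + 2 * (((-(d₃ : ℤ)) + (5 : ℤ)) % ((11 : ℕ) : ℤ) - (5 : ℤ)) ^ 2 < ((11 : ℕ) : ℤ) ^ 2) ∨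
      (0 < (((2 * (d₃ : ℤ)) + (5 : ℤ)) % ((11 : ℕ) : ℤ) - (5 : ℤ)) ^ 2 + (((2 * (d₃ : ℤ)) + (5 : ℤ)) % ((11 : ℕ) : ℤ) - (5 : ℤ)) * ((((d₁ : ℤ)) + (5 : ℤ)) % ((11 : ℕ) : ℤ) - (5 : ℤ)) + 2 * ((((d₁ : ℤ)) + (5 : ℤ)) % ((11 : ℕ) : ℤ) - (5 : ℤ)) ^ 2 + (((-2 * (d₂ : ℤ)) + (5 : ℤ)) % ((11 : ℕ) : ℤ) - (5 : ℤ)) ^ 2 + (((-2 * (d₂ : ℤ)) + (5 : ℤ)) % ((11 : ℕ) : ℤ) - (5 : ℤ)) * (((-(d₀ : ℤ)) + (5 : ℤ)) % ((11 : ℕ) : ℤ) - (5 : ℤ)) + 2 * (((-(d₀ : ℤ)) + (5 : ℤ)) % ((11 : ℕ) : ℤ) - (5 : ℤ)) ^ 2 ∧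
        (((2 * (d₃ : ℤ)) + (5 : ℤ)) % ((11 : ℕ) : ℤ) - (5 : ℤ)) ^ 2 + (((2 * (d₃ : ℤ)) + (5 : ℤ)) % ((11 : ℕ) : ℤ) - (5 : ℤ)) * ((((d₁ : ℤ)) + (5 : ℤ)) % ((11 : ℕ) : ℤ) - (5 : ℤ)) + 2 * ((((d₁ : ℤ)) + (5 : ℤ)) % ((11 : ℕ) : ℤ) - (5 : ℤ)) ^ 2 + (((-2 * (d₂ : ℤ)) + (5 : ℤ)) % ((11 : ℕ) : ℤ) - (5 : ℤ)) ^ 2 + (((-2 * (d₂ : ℤ)) + (5 : ℤ)) % ((11 : ℕ) : ℤ) - (5 : ℤ)) * (((-(d₀ : ℤ)) + (5 : ℤ)) % ((11 : ℕ) : ℤ) - (5 : ℤ)) + 2 * (((-(d₀ : ℤ)) + (5 : ℤ)) % ((11 : ℕ) : ℤ) - (5 : ℤ)) ^ 2 < ((11 : ℕ) : ℤ) ^ 2) ∨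
      (0 < (((-(d₀ : ℤ) + (d₁ : ℤ) + (d₃ : ℤ)) + (5 : ℤ)) % ((11 : ℕ) : ℤ) - (5 : ℤ)) ^ 2 + (((-(d₀ : ℤ) + (d₁ : ℤ) + (d₃ : ℤ)) + (5 : ℤ)) % ((11 : ℕ) : ℤ) - (5 : ℤ)) * (((-(d₂ : ℤ) - (d₃ : ℤ)) + (5 : ℤ)) % ((11 : ℕ) : ℤ) - (5 : ℤ)) + 2 * (((-(d₂ : ℤ) - (d₃ : ℤ)) + (5 : ℤ)) % ((11 : ℕ) : ℤ) - (5 : ℤ)) ^ 2 + (((-(d₀ : ℤ) - (d₁ : ℤ) - (d₂ : ℤ)) + (5 : ℤ)) % ((11 : ℕ) : ℤ) - (5 : ℤ)) ^ 2 + (((-(d₀ : ℤ) - (d₁ : ℤ) - (d₂ : ℤ)) + (5 : ℤ)) % ((11 : ℕ) : ℤ) - (5 : ℤ)) * ((((d₂ : ℤ) - (d₃ : ℤ)) + (5 : ℤ)) % ((11 : ℕ) : ℤ) - (5 : ℤ)) + 2 * ((((d₂ : ℤ) - (d₃ : ℤ)) + (5 : ℤ)) % ((11 : ℕ) : ℤ)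 - (5 : ℤ)) ^ 2 ∧
        (((-(d₀ : ℤ) + (d₁ : ℤ) + (d₃ : ℤ)) + (5 : ℤ)) % ((11 : ℕ) : ℤ) - (5 : ℤ)) ^ 2 + (((-(d₀ : ℤ) + (d₁ : ℤ) + (d₃ : ℤ)) + (5 : ℤ)) % ((11 : ℕ) : ℤ) - (5 : ℤ)) * (((-(d₂ : ℤ) - (d₃ : ℤ)) + (5 : ℤ)) % ((11 : ℕ) : ℤ) - (5 : ℤ)) + 2 * (((-(d₂ : ℤ) - (d₃ : ℤ)) + (5 : ℤ)) % ((11 : ℕ) : ℤ) - (5 : ℤ)) ^ 2 + (((-(d₀ : ℤ) - (d₁ : ℤ) - (d₂ : ℤ)) + (5 : ℤ)) % ((11 : ℕ) : ℤ) - (5 : ℤ)) ^ 2 + (((-(d₀ : ℤ) - (d₁ : ℤ) - (d₂ : ℤ)) + (5 : ℤ)) % ((11 : ℕ) : ℤ) - (5 : ℤ)) * ((((d₂ : ℤ) - (d₃ : ℤ)) + (5 : ℤ)) % ((11 : ℕ) : ℤ) - (5 : ℤ)) + 2 * ((((d₂ : ℤ) - (d₃ : ℤ)) + (5 : ℤ))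 % ((11 : ℕ) : ℤ) - (5 : ℤ)) ^ 2 < ((11 : ℕ) : ℤ) ^ 2) := by
  decide +kernel

set_option synthInstance.maxHeartbeats 400000 in
set_option synthInstance.maxSize 4000 in
/-- **The Dedekind–Hasse certificates at `p = 13`**: for every `δ = d₀ + d₁i + d₂ω + d₃iω ∈ O₇ ∖ 13O₇` (residues
`0 ≤ dᵢ < 13`, not all `0`) one of the four multipliers `α ∈ {−i, −1, −iω, −1−i}` gives a centred lift `c` of the coordinates of
`δα` mod `13` with `0 < Q₇(c) < 13²` (checked by the kernel, `decide`; cf. the PARI/GP verification of the source).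
[cite: CardosoMachiavelo2025, Thm. 7 and §5.1 Thm. 8 (the finite check for H₁,₇ at p ≤ 13)] -/
private theorem cert_13 : ∀ d₀ < (13 : ℕ), ∀ d₁ < (13 : ℕ), ∀ d₂ < (13 : ℕ), ∀ d₃ < (13 : ℕ),
    (d₀ ≠ 0 ∨ d₁ ≠ 0 ∨ d₂ ≠ 0 ∨ d₃ ≠ 0) →
      (0 < ((((d₁ : ℤ) + (d₃ : ℤ)) + (6 : ℤ)) % ((13 : ℕ) : ℤ) - (6 : ℤ)) ^ 2 + ((((d₁ : ℤ) + (d₃ : ℤ)) + (6 : ℤ)) % ((13 : ℕ) : ℤ) - (6 : ℤ)) * (((-(d₃ : ℤ)) + (6 : ℤ)) % ((13 : ℕ) : ℤ) - (6 : ℤ)) + 2 * (((-(d₃ : ℤ)) + (6 : ℤ)) % ((13 : ℕ) : ℤ) - (6 : ℤ)) ^ 2 + (((-(d₀ : ℤ) - (d₂ : ℤ)) + (6 : ℤ)) % ((13 : ℕ) : ℤ) - (6 : ℤ)) ^ 2 + (((-(d₀ : ℤ) - (d₂ : ℤ)) + (6 : ℤ)) % ((13 : ℕ) : ℤ) - (6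 : ℤ)) * ((((d₂ : ℤ)) + (6 : ℤ)) % ((13 : ℕ) : ℤ) - (6 : ℤ)) + 2 * ((((d₂ : ℤ)) + (6 : ℤ)) % ((13 : ℕ) : ℤ) - (6 : ℤ)) ^ 2 ∧
        ((((d₁ : ℤ) + (d₃ : ℤ)) + (6 : ℤ)) % ((13 : ℕ) : ℤ) - (6 : ℤ)) ^ 2 + ((((d₁ : ℤ) + (d₃ : ℤ)) + (6 : ℤ)) % ((13 : ℕ) : ℤ) - (6 : ℤ)) * (((-(d₃ : ℤ)) + (6 : ℤ)) % ((13 : ℕ) : ℤ) - (6 : ℤ)) + 2 * (((-(d₃ : ℤ)) + (6 : ℤ)) % ((13 : ℕ) : ℤ) - (6 : ℤ)) ^ 2 + (((-(d₀ : ℤ) - (d₂ : ℤ)) + (6 : ℤ)) % ((13 : ℕ) : ℤ) - (6 : ℤ)) ^ 2 + (((-(d₀ : ℤ) - (d₂ : ℤ)) + (6 : ℤ)) % ((13 : ℕ) : ℤ) - (6 : ℤ)) * ((((d₂ : ℤ)) + (6 : ℤ)) % ((13 : ℕ) : ℤ) - (6 : ℤ)) + 2 * ((((d₂ : ℤ))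 + (6 : ℤ)) % ((13 : ℕ) : ℤ) - (6 : ℤ)) ^ 2 < ((13 : ℕ) : ℤ) ^ 2) ∨
      (0 < (((-(d₀ : ℤ)) + (6 : ℤ)) % ((13 : ℕ) : ℤ) - (6 : ℤ)) ^ 2 + (((-(d₀ : ℤ)) + (6 : ℤ)) % ((13 : ℕ) : ℤ) - (6 : ℤ)) * (((-(d₂ : ℤ)) + (6 : ℤ)) % ((13 : ℕ) : ℤ) - (6 : ℤ)) + 2 * (((-(d₂ : ℤ)) + (6 : ℤ)) % ((13 : ℕ) : ℤ) - (6 : ℤ)) ^ 2 + (((-(d₁ : ℤ)) + (6 : ℤ)) % ((13 : ℕ) : ℤ) - (6 : ℤ)) ^ 2 + (((-(d₁ : ℤ)) + (6 : ℤ)) % ((13 : ℕ) : ℤ) - (6 : ℤ)) * (((-(d₃ : ℤ)) + (6 : ℤ)) % ((13 : ℕ) : ℤ) - (6 : ℤ)) + 2 * (((-(d₃ : ℤ)) + (6 : ℤ)) % ((13 : ℕ) : ℤ) - (6 : ℤ)) ^ 2 ∧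
        (((-(d₀ : ℤ)) + (6 : ℤ)) % ((13 : ℕ) : ℤ) - (6 : ℤ)) ^ 2 + (((-(d₀ : ℤ)) + (6 : ℤ)) % ((13 : ℕ) : ℤ) - (6 : ℤ)) * (((-(d₂ : ℤ)) + (6 : ℤ)) % ((13 : ℕ) : ℤ) - (6 : ℤ)) + 2 * (((-(d₂ : ℤ)) + (6 : ℤ)) % ((13 : ℕ) : ℤ) - (6 : ℤ)) ^ 2 + (((-(d₁ : ℤ)) + (6 : ℤ)) % ((13 : ℕ) : ℤ) - (6 : ℤ)) ^ 2 + (((-(d₁ : ℤ)) + (6 : ℤ)) % ((13 : ℕ) : ℤ) - (6 : ℤ)) * (((-(d₃ : ℤ)) + (6 : ℤ)) % ((13 : ℕ) : ℤ) - (6 : ℤ)) + 2 * (((-(d₃ : ℤ)) + (6 : ℤ)) % ((13 : ℕ) : ℤ) - (6 : ℤ)) ^ 2 < ((13 : ℕ) : ℤ) ^ 2) ∨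
      (0 < (((2 * (d₃ : ℤ)) + (6 : ℤ)) % ((13 : ℕ) : ℤ) - (6 : ℤ)) ^ 2 + (((2 * (d₃ : ℤ)) + (6 : ℤ)) % ((13 : ℕ) : ℤ) - (6 : ℤ)) * ((((d₁ : ℤ)) + (6 : ℤ)) % ((13 : ℕ) : ℤ) - (6 : ℤ)) + 2 * ((((d₁ : ℤ)) + (6 : ℤ)) % ((13 : ℕ) : ℤ) - (6 : ℤ)) ^ 2 + (((-2 * (d₂ : ℤ)) + (6 : ℤ)) % ((13 : ℕ) : ℤ) - (6 : ℤ)) ^ 2 + (((-2 * (d₂ : ℤ)) + (6 : ℤ)) % ((13 : ℕ) : ℤ) - (6 : ℤ)) * (((-(d₀ : ℤ)) + (6 : ℤ)) % ((13 : ℕ) : ℤ) - (6 : ℤ)) + 2 * (((-(d₀ : ℤ)) + (6 : ℤ)) % ((13 : ℕ) : ℤ) - (6 : ℤ)) ^ 2 ∧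
        (((2 * (d₃ : ℤ)) + (6 : ℤ)) % ((13 : ℕ) : ℤ) - (6 : ℤ)) ^ 2 + (((2 * (d₃ : ℤ)) + (6 : ℤ)) % ((13 : ℕ) : ℤ) - (6 : ℤ)) * ((((d₁ : ℤ)) + (6 : ℤ)) % ((13 : ℕ) : ℤ) - (6 : ℤ)) + 2 * ((((d₁ : ℤ)) + (6 : ℤ)) % ((13 : ℕ) : ℤ) - (6 : ℤ)) ^ 2 + (((-2 * (d₂ : ℤ)) + (6 : ℤ)) % ((13 : ℕ) : ℤ) - (6 : ℤ)) ^ 2 + (((-2 * (d₂ : ℤ)) + (6 : ℤ)) % ((13 : ℕ) : ℤ) - (6 : ℤ)) * (((-(d₀ : ℤ)) + (6 : ℤ)) % ((13 : ℕ) : ℤ) - (6 : ℤ)) + 2 * (((-(d₀ : ℤ)) + (6 : ℤ)) % ((13 : ℕ) : ℤ) - (6 : ℤ)) ^ 2 < ((13 : ℕ) : ℤ) ^ 2) ∨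
      (0 < (((-(d₀ : ℤ) + (d₁ : ℤ) + (d₃ : ℤ)) + (6 : ℤ)) % ((13 : ℕ) : ℤ) - (6 : ℤ)) ^ 2 + (((-(d₀ : ℤ) + (d₁ : ℤ) + (d₃ : ℤ)) + (6 : ℤ)) % ((13 : ℕ) : ℤ) - (6 : ℤ)) * (((-(d₂ : ℤ) - (d₃ : ℤ)) + (6 : ℤ)) % ((13 : ℕ) : ℤ) - (6 : ℤ)) + 2 * (((-(d₂ : ℤ) - (d₃ : ℤ)) + (6 : ℤ)) % ((13 : ℕ) : ℤ) - (6 : ℤ)) ^ 2 + (((-(d₀ : ℤ) - (d₁ : ℤ) - (d₂ : ℤ)) + (6 : ℤ)) % ((13 : ℕ) : ℤ) - (6 : ℤ)) ^ 2 + (((-(d₀ : ℤ) - (d₁ : ℤ) - (d₂ : ℤ)) + (6 : ℤ)) % ((13 : ℕ) : ℤ) - (6 : ℤ)) * ((((d₂ : ℤ) - (d₃ : ℤ)) + (6 : ℤ)) % ((13 : ℕ) : ℤ) - (6 : ℤ)) + 2 * ((((d₂ : ℤ) - (d₃ : ℤ)) + (6 : ℤ)) % ((13 : ℕ) : ℤ)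 - (6 : ℤ)) ^ 2 ∧
        (((-(d₀ : ℤ) + (d₁ : ℤ) + (d₃ : ℤ)) + (6 : ℤ)) % ((13 : ℕ) : ℤ) - (6 : ℤ)) ^ 2 + (((-(d₀ : ℤ) + (d₁ : ℤ) + (d₃ : ℤ)) + (6 : ℤ)) % ((13 : ℕ) : ℤ) - (6 : ℤ)) * (((-(d₂ : ℤ) - (d₃ : ℤ)) + (6 : ℤ)) % ((13 : ℕ) : ℤ) - (6 : ℤ)) + 2 * (((-(d₂ : ℤ) - (d₃ : ℤ)) + (6 : ℤ)) % ((13 : ℕ) : ℤ) - (6 : ℤ)) ^ 2 + (((-(d₀ : ℤ) - (d₁ : ℤ) - (d₂ : ℤ)) + (6 : ℤ)) % ((13 : ℕ) : ℤ) - (6 : ℤ)) ^ 2 + (((-(d₀ : ℤ) - (d₁ : ℤ) - (d₂ : ℤ)) + (6 : ℤ)) % ((13 : ℕ) : ℤ) - (6 : ℤ)) * ((((d₂ : ℤ) - (d₃ : ℤ)) + (6 : ℤ)) % ((13 : ℕ) : ℤ) - (6 : ℤ)) + 2 * ((((d₂ : ℤ) - (d₃ : ℤ)) + (6 : ℤ))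 % ((13 : ℕ) : ℤ) - (6 : ℤ)) ^ 2 < ((13 : ℕ) : ℤ) ^ 2) := by
  decide +kernel

/-- **Soundness of the certificates**: the disjunction of `cert_p` at the residues `(d₀, d₁, d₂, d₃)` yields multipliers for
`δ = d₀ + d₁i + d₂ω + d₃iω`. [cite: CardosoMachiavelo2025, Prop. 3 and Thm. 7] -/
private theorem cert_sound (p : ℕ) (hp : 0 < p) (h : ℤ) (d₀ d₁ d₂ d₃ : ℕ)
    (H : (0 < ((((d₁ : ℤ) + (d₃ : ℤ)) + h) % (p : ℤ) - h) ^ 2 + ((((d₁ : ℤ) + (d₃ : ℤ)) + h) % (p : ℤ) - h) * (((-(d₃ : ℤ)) + h) % (p : ℤ) - h) + 2 * (((-(d₃ : ℤ)) + h) % (p : ℤ) - h) ^ 2 + (((-(d₀ : ℤ) - (d₂ : ℤ)) + h) % (p : ℤ) - h) ^ 2 + (((-(d₀ : ℤ) - (d₂ : ℤ)) + h) % (p : ℤ) - h) * ((((d₂ : ℤ)) + h) % (p : ℤ) - h) + 2 * ((((d₂ : ℤ)) + h) % (p : ℤ) - h) ^ 2 ∧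
        ((((d₁ : ℤ) + (d₃ : ℤ)) + h) % (p : ℤ) - h) ^ 2 + ((((d₁ : ℤ) + (d₃ : ℤ)) + h) % (p : ℤ) - h) * (((-(d₃ : ℤ)) + h) % (p : ℤ) - h) + 2 * (((-(d₃ : ℤ)) + h) % (p : ℤ) - h) ^ 2 + (((-(d₀ : ℤ) - (d₂ : ℤ)) + h) % (p : ℤ) - h) ^ 2 + (((-(d₀ : ℤ) - (d₂ : ℤ)) + h) % (p : ℤ) - h) * ((((d₂ : ℤ)) + h) % (p : ℤ) - h) + 2 * ((((d₂ : ℤ)) + h) % (p : ℤ) - h) ^ 2 < (p : ℤ) ^ 2) ∨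
      (0 < (((-(d₀ : ℤ)) + h) % (p : ℤ) - h) ^ 2 + (((-(d₀ : ℤ)) + h) % (p : ℤ) - h) * (((-(d₂ : ℤ)) + h) % (p : ℤ) - h) + 2 * (((-(d₂ : ℤ)) + h) % (p : ℤ) - h) ^ 2 + (((-(d₁ : ℤ)) + h) % (p : ℤ) - h) ^ 2 + (((-(d₁ : ℤ)) + h) % (p : ℤ) - h) * (((-(d₃ : ℤ)) + h) % (p : ℤ) - h) + 2 * (((-(d₃ : ℤ)) + h) % (p : ℤ) - h) ^ 2 ∧
        (((-(d₀ : ℤ)) + h) % (p : ℤ) - h) ^ 2 + (((-(d₀ : ℤ)) + h) % (p : ℤ) - h) * (((-(d₂ : ℤ)) + h) % (p : ℤ) - h) + 2 * (((-(d₂ : ℤ)) + h) % (p : ℤ) - h) ^ 2 + (((-(d₁ : ℤ)) + h) % (p : ℤ) - h) ^ 2 + (((-(d₁ : ℤ)) + h) % (p : ℤ) - h) * (((-(d₃ : ℤ)) + h) % (p : ℤ) - h) + 2 * (((-(d₃ : ℤ)) + h) % (p : ℤ) - h) ^ 2 < (p : ℤ) ^ 2) ∨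
      (0 < (((2 * (d₃ : ℤ)) + h) % (p : ℤ) - h) ^ 2 + (((2 * (d₃ : ℤ)) + h) % (p : ℤ) - h) * ((((d₁ : ℤ)) + h) % (p : ℤ) - h) + 2 * ((((d₁ : ℤ)) + h) % (p : ℤ) - h) ^ 2 + (((-2 * (d₂ : ℤ)) + h) % (p : ℤ) - h) ^ 2 + (((-2 * (d₂ : ℤ)) + h) % (p : ℤ) - h) * (((-(d₀ : ℤ)) + h) % (p : ℤ) - h) + 2 * (((-(d₀ : ℤ)) + h) % (p : ℤ) - h) ^ 2 ∧
        (((2 * (d₃ : ℤ)) + h) % (p : ℤ) - h) ^ 2 + (((2 * (d₃ : ℤ)) + h) % (p : ℤ) - h) * ((((d₁ : ℤ)) + h) % (p : ℤ) - h) + 2 * ((((d₁ : ℤ)) + h) % (p : ℤ) - h) ^ 2 + (((-2 * (d₂ : ℤ)) + h) % (p : ℤ) - h) ^ 2 + (((-2 * (d₂ : ℤ)) + h) % (p : ℤ) - h) * (((-(d₀ : ℤ)) + h) % (p : ℤ) - h) + 2 * (((-(d₀ : ℤ)) + h) % (p : ℤ) - h) ^ 2 < (p : ℤ) ^ 2)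 ∨
      (0 < (((-(d₀ : ℤ) + (d₁ : ℤ) + (d₃ : ℤ)) + h) % (p : ℤ) - h) ^ 2 + (((-(d₀ : ℤ) + (d₁ : ℤ) + (d₃ : ℤ)) + h) % (p : ℤ) - h) * (((-(d₂ : ℤ) - (d₃ : ℤ)) + h) % (p : ℤ) - h) + 2 * (((-(d₂ : ℤ) - (d₃ : ℤ)) + h) % (p : ℤ) - h) ^ 2 + (((-(d₀ : ℤ) - (d₁ : ℤ) - (d₂ : ℤ)) + h) % (p : ℤ) - h) ^ 2 + (((-(d₀ : ℤ) - (d₁ : ℤ) - (d₂ : ℤ)) + h) % (p : ℤ) - h) * ((((d₂ : ℤ) - (d₃ : ℤ)) + h) % (p : ℤ) - h) + 2 * ((((d₂ : ℤ) - (d₃ : ℤ)) + h) % (p : ℤ) - h) ^ 2 ∧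
        (((-(d₀ : ℤ) + (d₁ : ℤ) + (d₃ : ℤ)) + h) % (p : ℤ) - h) ^ 2 + (((-(d₀ : ℤ) + (d₁ : ℤ) + (d₃ : ℤ)) + h) % (p : ℤ) - h) * (((-(d₂ : ℤ) - (d₃ : ℤ)) + h) % (p : ℤ) - h) + 2 * (((-(d₂ : ℤ) - (d₃ : ℤ)) + h) % (p : ℤ) - h) ^ 2 + (((-(d₀ : ℤ) - (d₁ : ℤ) - (d₂ : ℤ)) + h) % (p : ℤ) - h) ^ 2 + (((-(d₀ : ℤ) - (d₁ : ℤ) - (d₂ : ℤ)) + h) % (p : ℤ) - h) * ((((d₂ : ℤ) - (d₃ : ℤ)) + h) % (p : ℤ) - h) + 2 * ((((d₂ : ℤ) - (d₃ : ℤ)) + h) % (p : ℤ) - h) ^ 2 < (p : ℤ) ^ 2)) :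
    ∃ α ∈ (Submodule.span ℤ (Set.range ![(⟨1, 0, 0, 0⟩ : ℍ[ℚ,-1,-7]), ⟨0, 1, 0, 0⟩, ⟨1/2, 0, 1/2, 0⟩, ⟨0, 1/2, 0, 1/2⟩])), ∃ β ∈ (Submodule.span ℤ (Set.range ![(⟨1, 0, 0, 0⟩ : ℍ[ℚ,-1,-7]), ⟨0, 1, 0, 0⟩, ⟨1/2, 0, 1/2, 0⟩, ⟨0, 1/2, 0, 1/2⟩])),
      0 < reducedNorm ℚ ℍ[ℚ,-1,-7] (((p : ℚ)⁻¹ • (⟨((d₀ : ℤ) : ℚ) + ((d₂ : ℤ) : ℚ) / 2, ((d₁ : ℤ) : ℚ) + ((d₃ : ℤ) : ℚ) / 2,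
          ((d₂ : ℤ) : ℚ) / 2, ((d₃ : ℤ) : ℚ) / 2⟩ : ℍ[ℚ,-1,-7])) * α - β) ∧
        reducedNorm ℚ ℍ[ℚ,-1,-7] (((p : ℚ)⁻¹ • (⟨((d₀ : ℤ) : ℚ) + ((d₂ : ℤ) : ℚ) / 2, ((d₁ : ℤ) : ℚ) + ((d₃ : ℤ) : ℚ) / 2,
          ((d₂ : ℤ) : ℚ) / 2, ((d₃ : ℤ) : ℚ) / 2⟩ : ℍ[ℚ,-1,-7])) * α - β) < 1 := by
  rcases H with ⟨h1, h2⟩ | ⟨h1, h2⟩ | ⟨h1, h2⟩ | ⟨h1, h2⟩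
  · exact ⟨_, mk_mem_lattice 0 (-1) 0 0, exists_beta hp (mk_mem_lattice 0 (-1) 0 0) (mk_mul_negI _ _ _ _)
      (centred_modEq _ h _) (centred_modEq _ h _) (centred_modEq _ h _) (centred_modEq _ h _) h1 h2⟩
  · exact ⟨_, mk_mem_lattice (-1) 0 0 0, exists_beta hp (mk_mem_lattice (-1) 0 0 0) (mk_mul_negOne _ _ _ _)
      (centred_modEq _ h _) (centred_modEq _ h _) (centred_modEq _ h _) (centred_modEq _ h _) h1 h2⟩
  · exact ⟨_, mk_mem_lattice 0 0 0 (-1), exists_beta hp (mk_mem_lattice 0 0 0 (-1)) (mk_mul_negIOmega _ _ _ _)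
      (centred_modEq _ h _) (centred_modEq _ h _) (centred_modEq _ h _) (centred_modEq _ h _) h1 h2⟩
  · exact ⟨_, mk_mem_lattice (-1) (-1) 0 0, exists_beta hp (mk_mem_lattice (-1) (-1) 0 0) (mk_mul_negOneNegI _ _ _ _)
      (centred_modEq _ h _) (centred_modEq _ h _) (centred_modEq _ h _) (centred_modEq _ h _) h1 h2⟩

/-- **Every `δ ∈ O₇` with `δ/p ∉ O₇`, `p ≤ 13` prime, admits `α, β ∈ O₇` with `0 < nrd((δ/p)α − β) < 1`** (reduce the
coordinates of `δ` mod `p` and apply the certificate). [cite: CardosoMachiavelo2025, Thm. 4, Thm. 7 and §5.1 Thm. 8] -/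
theorem exists_alpha_beta_of_prime_le {p : ℕ} (hp : p.Prime) (hle : p ≤ 13) {x : ℍ[ℚ,-1,-7]} (hx : x ∈ (Submodule.span ℤ (Set.range ![(⟨1, 0, 0, 0⟩ : ℍ[ℚ,-1,-7]), ⟨0, 1, 0, 0⟩, ⟨1/2, 0, 1/2, 0⟩, ⟨0, 1/2, 0, 1/2⟩])))
    (hnot : (p : ℚ)⁻¹ • x ∉ (Submodule.span ℤ (Set.range ![(⟨1, 0, 0, 0⟩ : ℍ[ℚ,-1,-7]), ⟨0, 1, 0, 0⟩, ⟨1/2, 0, 1/2, 0⟩, ⟨0, 1/2, 0, 1/2⟩]))) :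
    ∃ α ∈ (Submodule.span ℤ (Set.range ![(⟨1, 0, 0, 0⟩ : ℍ[ℚ,-1,-7]), ⟨0, 1, 0, 0⟩, ⟨1/2, 0, 1/2, 0⟩, ⟨0, 1/2, 0, 1/2⟩])), ∃ β ∈ (Submodule.span ℤ (Set.range ![(⟨1, 0, 0, 0⟩ : ℍ[ℚ,-1,-7]), ⟨0, 1, 0, 0⟩, ⟨1/2, 0, 1/2, 0⟩, ⟨0, 1/2, 0, 1/2⟩])),
      0 < reducedNorm ℚ ℍ[ℚ,-1,-7] (((p : ℚ)⁻¹ • x) * α - β) ∧ reducedNorm ℚ ℍ[ℚ,-1,-7] (((p : ℚ)⁻¹ • x) * α - β) < 1 := by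
  have hp0 : 0 < p := hp.pos
  have hpz : (0 : ℤ) < p := by exact_mod_cast hp0
  have hp' : (p : ℚ) ≠ 0 := by exact_mod_cast hp0.ne'
  obtain ⟨X₀, X₁, X₂, X₃, rfl⟩ := (mem_lattice_iff x).1 hx
  -- the residues `dᵢ = Xᵢ mod p ∈ [0, p)` and the quotients `tᵢ`
  obtain ⟨d₀, hd₀, hd₀p⟩ : ∃ d : ℕ, (d : ℤ) = X₀ % p ∧ d < p :=
    ⟨(X₀ % p).toNat, Int.toNat_of_nonneg (Int.emod_nonneg _ hpz.ne'),
      by have := Int.emod_lt_of_pos X₀ hpz; omega⟩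
  obtain ⟨d₁, hd₁, hd₁p⟩ : ∃ d : ℕ, (d : ℤ) = X₁ % p ∧ d < p :=
    ⟨(X₁ % p).toNat, Int.toNat_of_nonneg (Int.emod_nonneg _ hpz.ne'),
      by have := Int.emod_lt_of_pos X₁ hpz; omega⟩
  obtain ⟨d₂, hd₂, hd₂p⟩ : ∃ d : ℕ, (d : ℤ) = X₂ % p ∧ d < p :=
    ⟨(X₂ % p).toNat, Int.toNat_of_nonneg (Int.emod_nonneg _ hpz.ne'),
      by have := Int.emod_lt_of_pos X₂ hpz; omega⟩
  obtain ⟨d₃, hd₃, hd₃p⟩ : ∃ d : ℕ, (d : ℤ) = X₃ % p ∧ d < p :=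
    ⟨(X₃ % p).toNat, Int.toNat_of_nonneg (Int.emod_nonneg _ hpz.ne'),
      by have := Int.emod_lt_of_pos X₃ hpz; omega⟩
  have e₀ : X₀ = (d₀ : ℤ) + p * (X₀ / p) := by rw [hd₀]; linarith [Int.emod_add_mul_ediv X₀ (p : ℤ)]
  have e₁ : X₁ = (d₁ : ℤ) + p * (X₁ / p) := by rw [hd₁]; linarith [Int.emod_add_mul_ediv X₁ (p : ℤ)]
  have e₂ : X₂ = (d₂ : ℤ) + p * (X₂ / p) := by rw [hd₂]; linarith [Int.emod_add_mul_ediv X₂ (p : ℤ)]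
  have e₃ : X₃ = (d₃ : ℤ) + p * (X₃ / p) := by rw [hd₃]; linarith [Int.emod_add_mul_ediv X₃ (p : ℤ)]
  have e : (⟨(X₀ : ℚ) + (X₂ : ℚ) / 2, (X₁ : ℚ) + (X₃ : ℚ) / 2, (X₂ : ℚ) / 2, (X₃ : ℚ) / 2⟩ : ℍ[ℚ,-1,-7]) =
      ⟨((d₀ : ℤ) : ℚ) + ((d₂ : ℤ) : ℚ) / 2, ((d₁ : ℤ) : ℚ) + ((d₃ : ℤ) : ℚ) / 2, ((d₂ : ℤ) : ℚ) / 2, ((d₃ : ℤ) : ℚ) / 2⟩ +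
        (p : ℚ) • ⟨((X₀ / p : ℤ) : ℚ) + ((X₂ / p : ℤ) : ℚ) / 2, ((X₁ / p : ℤ) : ℚ) + ((X₃ / p : ℤ) : ℚ) / 2,
          ((X₂ / p : ℤ) : ℚ) / 2, ((X₃ / p : ℤ) : ℚ) / 2⟩ := by
    have hn : ((p : ℤ) : ℚ) = (p : ℚ) := by push_cast; rfl
    rw [← hn, mk_add_smul_mk, ← e₀, ← e₁, ← e₂, ← e₃]
  -- not all residues vanish (else `x/p ∈ O₇`)
  have hne : d₀ ≠ 0 ∨ d₁ ≠ 0 ∨ d₂ ≠ 0 ∨ d₃ ≠ 0 := by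
    by_contra hcon
    push Not at hcon
    obtain ⟨z₀, z₁, z₂, z₃⟩ := hcon
    apply hnot
    rw [e, z₀, z₁, z₂, z₃, smul_add, smul_smul, inv_mul_cancel₀ hp', one_smul]
    have hz : ((p : ℚ)⁻¹ • (⟨(((0 : ℕ) : ℤ) : ℚ) + (((0 : ℕ) : ℤ) : ℚ) / 2, (((0 : ℕ) : ℤ) : ℚ) + (((0 : ℕ) : ℤ) : ℚ) / 2,
        (((0 : ℕ) : ℤ) : ℚ) / 2, (((0 : ℕ) : ℤ) : ℚ) / 2⟩ : ℍ[ℚ,-1,-7])) = 0 := by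
      ext <;> simp
    rw [hz, zero_add]
    exact mk_mem_lattice _ _ _ _
  refine exists_of_add_smul hp0 (mk_mem_lattice _ _ _ _) e ?_
  have h2 := hp.two_le
  interval_cases p
  · exact cert_sound 2 hp0 0 d₀ d₁ d₂ d₃ (cert_2 d₀ hd₀p d₁ hd₁p d₂ hd₂p d₃ hd₃p hne)
  · exact cert_sound 3 hp0 1 d₀ d₁ d₂ d₃ (cert_3 d₀ hd₀p d₁ hd₁p d₂ hd₂p d₃ hd₃p hne)
  · exact absurd hp (by decide)
  · exact cert_sound 5 hp0 2 d₀ d₁ d₂ d₃ (cert_5 d₀ hd₀p d₁ hd₁p d₂ hd₂p d₃ hd₃p hne)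
  · exact absurd hp (by decide)
  · exact cert_sound 7 hp0 3 d₀ d₁ d₂ d₃ (cert_7 d₀ hd₀p d₁ hd₁p d₂ hd₂p d₃ hd₃p hne)
  · exact absurd hp (by decide)
  · exact absurd hp (by decide)
  · exact absurd hp (by decide)
  · exact cert_sound 11 hp0 5 d₀ d₁ d₂ d₃ (cert_11 d₀ hd₀p d₁ hd₁p d₂ hd₂p d₃ hd₃p hne)
  · exact absurd hp (by decide)
  · exact cert_sound 13 hp0 6 d₀ d₁ d₂ d₃ (cert_13 d₀ hd₀p d₁ hd₁p d₂ hd₂p d₃ hd₃p hne)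

end Certificates

/-! ## §3 The primes `p ≥ 17`: a pigeonhole multiplier -/

section LargePrimes

/-- **Simultaneous approximation (Hardy–Wright Thm. 201 with `Q = 4`, two coordinates)**: for `p ≥ 1` and integers `X₂, X₃`
there is `1 ≤ u ≤ 16` such that `uX₂` and `uX₃` are congruent mod `p` to integers `c₂, c₃` with `4|cᵢ| < p` (the `17`
multiples `u = 0, …, 16` fall into the `16` boxes `⌊4(uXᵢ mod p)/p⌋ ∈ {0,1,2,3}²`). [cite: HardyWright2008, Thm. 201] [cite: CardosoMachiavelo2025, Thm. 5 and Thm. 6] -/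
theorem exists_small_multiple {p : ℕ} (hp : 0 < p) (X₂ X₃ : ℤ) :
    ∃ u : ℤ, 1 ≤ u ∧ u ≤ 16 ∧ ∃ c₂ c₃ : ℤ, c₂ ≡ u * X₂ [ZMOD (p : ℤ)] ∧ c₃ ≡ u * X₃ [ZMOD (p : ℤ)] ∧
      (-(p : ℤ) < 4 * c₂ ∧ 4 * c₂ < p) ∧ (-(p : ℤ) < 4 * c₃ ∧ 4 * c₃ < p) := by
  have hpz : (0 : ℤ) < p := by exact_mod_cast hp
  -- the box of `u`
  let f : ℕ → ℕ × ℕ := fun u => ((4 * ((u : ℤ) * X₂ % p) / p).toNat, (4 * ((u : ℤ) * X₃ % p) / p).toNat)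
  have hbox : ∀ (Y : ℤ) (u : ℕ), 0 ≤ 4 * ((u : ℤ) * Y % p) / p ∧ 4 * ((u : ℤ) * Y % p) / p < 4 := fun Y u => by
    have h0 : 0 ≤ (u : ℤ) * Y % p := Int.emod_nonneg _ hpz.ne'
    have h1 : (u : ℤ) * Y % p < p := Int.emod_lt_of_pos _ hpz
    exact ⟨Int.ediv_nonneg (by linarith) hpz.le, Int.ediv_lt_of_lt_mul hpz (by linarith)⟩
  have hf : ∀ u ∈ Finset.range 17, f u ∈ Finset.range 4 ×ˢ Finset.range 4 := by
    intro u _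
    simp only [f, Finset.mem_product, Finset.mem_range]
    obtain ⟨h2a, h2b⟩ := hbox X₂ u
    obtain ⟨h3a, h3b⟩ := hbox X₃ u
    constructor <;> omega
  have hcard : (Finset.range 4 ×ˢ Finset.range 4).card < (Finset.range 17).card := by simp
  obtain ⟨u₁, hu₁, u₂, hu₂, hne, heq⟩ := Finset.exists_ne_map_eq_of_card_lt_of_maps_to hcard hf
  rw [Finset.mem_range] at hu₁ hu₂
  simp only [f, Prod.mk.injEq] at heq
  obtain ⟨heq₂, heq₃⟩ := heq
  -- the two boxes coincide: the differences of residues are small lifts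
  have key : ∀ (Y : ℤ) (a b : ℕ), (4 * ((a : ℤ) * Y % p) / p).toNat = (4 * ((b : ℤ) * Y % p) / p).toNat →
      ((a : ℤ) * Y % p - (b : ℤ) * Y % p) ≡ ((a : ℤ) - b) * Y [ZMOD (p : ℤ)] ∧
        (-(p : ℤ) < 4 * ((a : ℤ) * Y % p - (b : ℤ) * Y % p) ∧ 4 * ((a : ℤ) * Y % p - (b : ℤ) * Y % p) < p) := by
    intro Y a b hab
    obtain ⟨ha0, ha4⟩ := hbox Y a
    obtain ⟨hb0, hb4⟩ := hbox Y b
    have hab' : 4 * ((a : ℤ) * Y % p) / p = 4 * ((b : ℤ) * Y % p) / p := by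
      have h := congrArg (fun n : ℕ => (n : ℤ)) hab
      simp only [Int.toNat_of_nonneg ha0, Int.toNat_of_nonneg hb0] at h
      exact h
    refine ⟨?_, ?_⟩
    · have h1 : (a : ℤ) * Y % p ≡ (a : ℤ) * Y [ZMOD (p : ℤ)] := Int.mod_modEq _ _
      have h2 : (b : ℤ) * Y % p ≡ (b : ℤ) * Y [ZMOD (p : ℤ)] := Int.mod_modEq _ _
      have h3 := h1.sub h2
      rwa [← sub_mul] at h3
    · have hA := Int.emod_add_mul_ediv (4 * ((a : ℤ) * Y % p)) p
      have hB := Int.emod_add_mul_ediv (4 * ((b : ℤ) * Y % p)) p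
      have hA0 : 0 ≤ 4 * ((a : ℤ) * Y % p) % p := Int.emod_nonneg _ hpz.ne'
      have hA1 : 4 * ((a : ℤ) * Y % p) % p < p := Int.emod_lt_of_pos _ hpz
      have hB0 : 0 ≤ 4 * ((b : ℤ) * Y % p) % p := Int.emod_nonneg _ hpz.ne'
      have hB1 : 4 * ((b : ℤ) * Y % p) % p < p := Int.emod_lt_of_pos _ hpz
      rw [hab'] at hA
      constructor <;> omega
  rcases lt_or_gt_of_ne hne with hlt | hlt
  · obtain ⟨hc₂, hb₂⟩ := key X₂ u₂ u₁ heq₂.symm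
    obtain ⟨hc₃, hb₃⟩ := key X₃ u₂ u₁ heq₃.symm
    exact ⟨(u₂ : ℤ) - u₁, by omega, by omega, _, _, hc₂, hc₃, hb₂, hb₃⟩
  · obtain ⟨hc₂, hb₂⟩ := key X₂ u₁ u₂ heq₂
    obtain ⟨hc₃, hb₃⟩ := key X₃ u₁ u₂ heq₃
    exact ⟨(u₁ : ℤ) - u₂, by omega, by omega, _, _, hc₂, hc₃, hb₂, hb₃⟩

/-- **The norm bound**: `2|c₀|, 2|c₁| ≤ p − 1` and `4|c₂|, 4|c₃| ≤ p − 1` (as two-sided bounds) imply `Q₇(c) < p²`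
(`64·Q₇(c) = (8c₀ + 4c₂)² + 7(4c₂)² + (8c₁ + 4c₃)² + 7(4c₃)² ≤ (25 + 7 + 25 + 7)(p − 1)²`). [cite: CardosoMachiavelo2025, Lemma 1 and §5.1 (`1/2 + 1/Q + 4/Q² ≤ 1` for `Q = 4`)] -/
theorem form_lt_sq {p c₀ c₁ c₂ c₃ : ℤ} (hp : 1 ≤ p) (a₀ : 2 * c₀ ≤ p - 1) (b₀ : -(p - 1) ≤ 2 * c₀)
    (a₁ : 2 * c₁ ≤ p - 1) (b₁ : -(p - 1) ≤ 2 * c₁) (a₂ : 4 * c₂ ≤ p - 1) (b₂ : -(p - 1) ≤ 4 * c₂)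
    (a₃ : 4 * c₃ ≤ p - 1) (b₃ : -(p - 1) ≤ 4 * c₃) :
    c₀ ^ 2 + c₀ * c₂ + 2 * c₂ ^ 2 + c₁ ^ 2 + c₁ * c₃ + 2 * c₃ ^ 2 < p ^ 2 := by
  have A : (8 * c₀ + 4 * c₂) ^ 2 ≤ 25 * (p - 1) ^ 2 := by
    nlinarith [mul_nonneg (show (0 : ℤ) ≤ 5 * (p - 1) - (8 * c₀ + 4 * c₂) by linarith)
      (show (0 : ℤ) ≤ 5 * (p - 1) + (8 * c₀ + 4 * c₂) by linarith)]
  have B : (4 * c₂) ^ 2 ≤ (p - 1) ^ 2 := by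
    nlinarith [mul_nonneg (show (0 : ℤ) ≤ (p - 1) - 4 * c₂ by linarith) (show (0 : ℤ) ≤ (p - 1) + 4 * c₂ by linarith)]
  have C : (8 * c₁ + 4 * c₃) ^ 2 ≤ 25 * (p - 1) ^ 2 := by
    nlinarith [mul_nonneg (show (0 : ℤ) ≤ 5 * (p - 1) - (8 * c₁ + 4 * c₃) by linarith)
      (show (0 : ℤ) ≤ 5 * (p - 1) + (8 * c₁ + 4 * c₃) by linarith)]
  have D : (4 * c₃) ^ 2 ≤ (p - 1) ^ 2 := by
    nlinarith [mul_nonneg (show (0 : ℤ) ≤ (p - 1) - 4 * c₃ by linarith) (show (0 : ℤ) ≤ (p - 1) + 4 * c₃ by linarith)]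
  have key : 64 * (c₀ ^ 2 + c₀ * c₂ + 2 * c₂ ^ 2 + c₁ ^ 2 + c₁ * c₃ + 2 * c₃ ^ 2) =
      (8 * c₀ + 4 * c₂) ^ 2 + 7 * (4 * c₂) ^ 2 + (8 * c₁ + 4 * c₃) ^ 2 + 7 * (4 * c₃) ^ 2 := by ring
  nlinarith

/-- `Q₇` is positive definite on `ℤ⁴`: `Q₇(c) ≤ 0` forces `c = 0` (`4Q₇ = (2c₀+c₂)² + 7c₂² + (2c₁+c₃)² + 7c₃²`). [folklore] -/
private theorem eq_zero_of_form_nonpos {c₀ c₁ c₂ c₃ : ℤ} (h : c₀ ^ 2 + c₀ * c₂ + 2 * c₂ ^ 2 + c₁ ^ 2 + c₁ * c₃ + 2 * c₃ ^ 2 ≤ 0) :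
    c₀ = 0 ∧ c₁ = 0 ∧ c₂ = 0 ∧ c₃ = 0 := by
  have h2 : c₂ = 0 := by nlinarith [sq_nonneg (2 * c₀ + c₂), sq_nonneg (2 * c₁ + c₃), sq_nonneg c₃, sq_nonneg c₂]
  have h3 : c₃ = 0 := by nlinarith [sq_nonneg (2 * c₀ + c₂), sq_nonneg (2 * c₁ + c₃), sq_nonneg c₃, sq_nonneg c₂]
  subst h2 h3
  have h0 : c₀ = 0 := by nlinarith [sq_nonneg c₀, sq_nonneg c₁]
  have h1 : c₁ = 0 := by nlinarith [sq_nonneg c₀, sq_nonneg c₁]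
  exact ⟨h0, h1, rfl, rfl⟩

/-- **Every `δ ∈ O₇` with `δ/p ∉ O₇`, `p ≥ 17` prime, admits `α, β ∈ O₇` with `0 < nrd((δ/p)α − β) < 1`**, with the scalar
multiplier `α = u` of `exists_small_multiple` (the coordinates of `uδ` reduce mod `p` to `c` with `2|c₀|, 2|c₁| ≤ p − 1`,
`4|c₂|, 4|c₃| < p`, so `0 < Q₇(c) < p²`; `c ≠ 0` because `p ∤ u` and `δ ∉ pO₇`). [cite: CardosoMachiavelo2025, Lemma 1, Thm. 6 and §5.1 (primes p > 4² are automatic)] [cite: HardyWright2008, Thm. 201] -/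
theorem exists_alpha_beta_of_seventeen_le {p : ℕ} (hp : p.Prime) (h17 : 17 ≤ p) {x : ℍ[ℚ,-1,-7]} (hx : x ∈ (Submodule.span ℤ (Set.range ![(⟨1, 0, 0, 0⟩ : ℍ[ℚ,-1,-7]), ⟨0, 1, 0, 0⟩, ⟨1/2, 0, 1/2, 0⟩, ⟨0, 1/2, 0, 1/2⟩])))
    (hnot : (p : ℚ)⁻¹ • x ∉ (Submodule.span ℤ (Set.range ![(⟨1, 0, 0, 0⟩ : ℍ[ℚ,-1,-7]), ⟨0, 1, 0, 0⟩, ⟨1/2, 0, 1/2, 0⟩, ⟨0, 1/2, 0, 1/2⟩]))) :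
    ∃ α ∈ (Submodule.span ℤ (Set.range ![(⟨1, 0, 0, 0⟩ : ℍ[ℚ,-1,-7]), ⟨0, 1, 0, 0⟩, ⟨1/2, 0, 1/2, 0⟩, ⟨0, 1/2, 0, 1/2⟩])), ∃ β ∈ (Submodule.span ℤ (Set.range ![(⟨1, 0, 0, 0⟩ : ℍ[ℚ,-1,-7]), ⟨0, 1, 0, 0⟩, ⟨1/2, 0, 1/2, 0⟩, ⟨0, 1/2, 0, 1/2⟩])),
      0 < reducedNorm ℚ ℍ[ℚ,-1,-7] (((p : ℚ)⁻¹ • x) * α - β) ∧ reducedNorm ℚ ℍ[ℚ,-1,-7] (((p : ℚ)⁻¹ • x) * α - β) < 1 := by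
  have hp0 : 0 < p := hp.pos
  have hpz : (0 : ℤ) < p := by exact_mod_cast hp0
  have hp' : (p : ℚ) ≠ 0 := by exact_mod_cast hp0.ne'
  obtain ⟨X₀, X₁, X₂, X₃, rfl⟩ := (mem_lattice_iff x).1 hx
  obtain ⟨u, hu1, hu16, c₂, c₃, hc₂, hc₃, hb₂, hb₃⟩ := exists_small_multiple hp0 X₂ X₃
  -- `p` is odd: `p = 2h + 1`
  obtain ⟨k, hk⟩ : Odd p := hp.odd_of_ne_two (by omega)
  have hk' : (p : ℤ) = 2 * k + 1 := by exact_mod_cast hk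
  -- the centred residues of `uX₀`, `uX₁`
  have hc : ∀ L : ℤ, 2 * ((L + k) % p - k) ≤ p - 1 ∧ -((p : ℤ) - 1) ≤ 2 * ((L + k) % p - k) := fun L => by
    have h0 : 0 ≤ (L + k) % p := Int.emod_nonneg _ hpz.ne'
    have h1 : (L + k) % p < p := Int.emod_lt_of_pos _ hpz
    constructor <;> omega
  have hlt := form_lt_sq (c₀ := (u * X₀ + k) % p - k) (c₁ := (u * X₁ + k) % p - k) (c₂ := c₂) (c₃ := c₃)
    (by omega : (1 : ℤ) ≤ p) (hc _).1 (hc _).2 (hc _).1 (hc _).2 (by omega) (by omega) (by omega) (by omega)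
  refine ⟨_, mk_mem_lattice u 0 0 0, exists_beta hp0 (mk_mem_lattice u 0 0 0) (mk_mul_intCast X₀ X₁ X₂ X₃ u)
    (centred_modEq _ k _) (centred_modEq _ k _) hc₂ hc₃ ?_ hlt⟩
  -- positivity: `c = 0` would put `x/p` in `O₇`
  by_contra hle
  push Not at hle
  obtain ⟨z₀, z₁, z₂, z₃⟩ := eq_zero_of_form_nonpos hle
  have hpr : Prime (p : ℤ) := Nat.prime_iff_prime_int.1 hp
  have hpu : ¬ (p : ℤ) ∣ u := fun h => by
    have := Int.le_of_dvd (by omega) h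
    omega
  have hdvd : ∀ {c X : ℤ}, c ≡ u * X [ZMOD (p : ℤ)] → c = 0 → (p : ℤ) ∣ X := by
    intro c X hcX hc0
    have h := hcX.dvd
    rw [hc0, sub_zero] at h
    exact (hpr.dvd_or_dvd h).resolve_left hpu
  obtain ⟨t₀, ht₀⟩ := hdvd (centred_modEq (u * X₀) k p) z₀
  obtain ⟨t₁, ht₁⟩ := hdvd (centred_modEq (u * X₁) k p) z₁
  obtain ⟨t₂, ht₂⟩ := hdvd hc₂ z₂
  obtain ⟨t₃, ht₃⟩ := hdvd hc₃ z₃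
  apply hnot
  have e : (p : ℚ)⁻¹ • (⟨(X₀ : ℚ) + (X₂ : ℚ) / 2, (X₁ : ℚ) + (X₃ : ℚ) / 2, (X₂ : ℚ) / 2, (X₃ : ℚ) / 2⟩ : ℍ[ℚ,-1,-7]) =
      ⟨(t₀ : ℚ) + (t₂ : ℚ) / 2, (t₁ : ℚ) + (t₃ : ℚ) / 2, (t₂ : ℚ) / 2, (t₃ : ℚ) / 2⟩ := by
    rw [ht₀, ht₁, ht₂, ht₃]
    ext <;> simp <;> field_simp
  rw [e]
  exact mk_mem_lattice t₀ t₁ t₂ t₃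

end LargePrimes

/-! ## §4 The Dedekind–Hasse criterion for `O₇` -/

section Criterion

/-- All primes: `δ ∈ O₇`, `δ/p ∉ O₇` ⟹ `∃ α, β ∈ O₇` with `0 < nrd((δ/p)α − β) < 1` (certificates for `p ≤ 13`, pigeonhole for
`p ≥ 17`; there is no prime in between). [cite: CardosoMachiavelo2025, Thm. 4, Thm. 6 and §5.1 Thm. 8] -/
theorem exists_alpha_beta_of_prime {p : ℕ} (hp : p.Prime) {x : ℍ[ℚ,-1,-7]} (hx : x ∈ (Submodule.span ℤ (Set.range ![(⟨1, 0, 0, 0⟩ : ℍ[ℚ,-1,-7]), ⟨0, 1, 0, 0⟩, ⟨1/2, 0, 1/2, 0⟩, ⟨0, 1/2, 0, 1/2⟩]))) (hnot : (p : ℚ)⁻¹ • x ∉ (Submodule.span ℤ (Set.range ![(⟨1, 0, 0, 0⟩ : ℍ[ℚ,-1,-7]), ⟨0, 1, 0, 0⟩, ⟨1/2, 0, 1/2, 0⟩, ⟨0, 1/2, 0, 1/2⟩]))) :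
    ∃ α ∈ (Submodule.span ℤ (Set.range ![(⟨1, 0, 0, 0⟩ : ℍ[ℚ,-1,-7]), ⟨0, 1, 0, 0⟩, ⟨1/2, 0, 1/2, 0⟩, ⟨0, 1/2, 0, 1/2⟩])), ∃ β ∈ (Submodule.span ℤ (Set.range ![(⟨1, 0, 0, 0⟩ : ℍ[ℚ,-1,-7]), ⟨0, 1, 0, 0⟩, ⟨1/2, 0, 1/2, 0⟩, ⟨0, 1/2, 0, 1/2⟩])),
      0 < reducedNorm ℚ ℍ[ℚ,-1,-7] (((p : ℚ)⁻¹ • x) * α - β) ∧ reducedNorm ℚ ℍ[ℚ,-1,-7] (((p : ℚ)⁻¹ • x) * α - β) < 1 := by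
  by_cases hle : p ≤ 13
  · exact exists_alpha_beta_of_prime_le hp hle hx hnot
  · by_cases h17 : 17 ≤ p
    · exact exists_alpha_beta_of_seventeen_le hp h17 hx hnot
    · exfalso
      interval_cases p <;> exact absurd hp (by decide)

/-- **THE DEDEKIND–HASSE CRITERION HOLDS FOR `O₇`** (Cardoso–Machiavelo Thm. 3 ∕ Thm. 8 for `H₁,₇`, right-multiplier form):
for every `ρ ∈ (−1,−7 ∣ ℚ)` not in `O₇` there are `α, β ∈ O₇` with `0 < nrd(ρα − β) < 1`. (Reduction: let `n ≥ 2` be the least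
positive integer with `nρ ∈ O₇`, `p` a prime factor, `m = n/p`; then `δ := nρ ∈ O₇`, `δ/p = mρ ∉ O₇`, and multipliers `α, β`
for `δ/p` give `mα, β` for `ρ`.) [cite: CardosoMachiavelo2025, Thm. 3, Thm. 4 and Thm. 8] -/
theorem dedekindHasse {ρ : ℍ[ℚ,-1,-7]} (hρ : ρ ∉ (Submodule.span ℤ (Set.range ![(⟨1, 0, 0, 0⟩ : ℍ[ℚ,-1,-7]), ⟨0, 1, 0, 0⟩, ⟨1/2, 0, 1/2, 0⟩, ⟨0, 1/2, 0, 1/2⟩]))) :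
    ∃ α ∈ (Submodule.span ℤ (Set.range ![(⟨1, 0, 0, 0⟩ : ℍ[ℚ,-1,-7]), ⟨0, 1, 0, 0⟩, ⟨1/2, 0, 1/2, 0⟩, ⟨0, 1/2, 0, 1/2⟩])), ∃ β ∈ (Submodule.span ℤ (Set.range ![(⟨1, 0, 0, 0⟩ : ℍ[ℚ,-1,-7]), ⟨0, 1, 0, 0⟩, ⟨1/2, 0, 1/2, 0⟩, ⟨0, 1/2, 0, 1/2⟩])), 0 < reducedNorm ℚ ℍ[ℚ,-1,-7] (ρ * α - β) ∧ reducedNorm ℚ ℍ[ℚ,-1,-7] (ρ * α - β) < 1 := by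
  classical
  -- a positive integer multiple of `ρ` lies in `O₇`
  have hex : ∃ n : ℕ, 0 < n ∧ (n : ℚ) • ρ ∈ (Submodule.span ℤ (Set.range ![(⟨1, 0, 0, 0⟩ : ℍ[ℚ,-1,-7]), ⟨0, 1, 0, 0⟩, ⟨1/2, 0, 1/2, 0⟩, ⟨0, 1/2, 0, 1/2⟩])) := by
    obtain ⟨N, hN0, hN⟩ := isFullLattice_lattice.2 ρ
    refine ⟨N.natAbs, Int.natAbs_pos.2 hN0, ?_⟩
    have e : ((N.natAbs : ℕ) : ℚ) • ρ = (N.natAbs : ℤ) • ρ := by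
      rw [← Int.cast_smul_eq_zsmul ℚ, Int.cast_natCast]
    rw [e]
    rcases Int.natAbs_eq N with h | h
    · rw [← h]; exact hN
    · have h' : (N.natAbs : ℤ) = -N := by omega
      rw [h', neg_smul]; exact ((Submodule.span ℤ (Set.range ![(⟨1, 0, 0, 0⟩ : ℍ[ℚ,-1,-7]), ⟨0, 1, 0, 0⟩, ⟨1/2, 0, 1/2, 0⟩, ⟨0, 1/2, 0, 1/2⟩]))).neg_mem hN
  -- the least such `n`
  let n := Nat.find hex
  obtain ⟨hn0, hn⟩ : 0 < n ∧ (n : ℚ) • ρ ∈ (Submodule.span ℤ (Set.range ![(⟨1, 0, 0, 0⟩ : ℍ[ℚ,-1,-7]), ⟨0, 1, 0, 0⟩, ⟨1/2, 0, 1/2, 0⟩, ⟨0, 1/2, 0, 1/2⟩])) := Nat.find_spec hex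
  have hmin : ∀ m : ℕ, 0 < m → (m : ℚ) • ρ ∈ (Submodule.span ℤ (Set.range ![(⟨1, 0, 0, 0⟩ : ℍ[ℚ,-1,-7]), ⟨0, 1, 0, 0⟩, ⟨1/2, 0, 1/2, 0⟩, ⟨0, 1/2, 0, 1/2⟩])) → n ≤ m := fun m hm hmρ => Nat.find_min' hex ⟨hm, hmρ⟩
  have hn1 : n ≠ 1 := by
    intro h
    rw [h, Nat.cast_one, one_smul] at hn
    exact hρ hn
  -- a prime factor `p`, `n = p * m`
  let p := n.minFac
  have hp : p.Prime := Nat.minFac_prime hn1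
  obtain ⟨m, hm⟩ : p ∣ n := Nat.minFac_dvd n
  have hm0 : 0 < m := Nat.pos_of_ne_zero (by rintro rfl; rw [mul_zero] at hm; omega)
  have hmn : m < n := by
    rw [hm]
    exact lt_mul_of_one_lt_left hm0 hp.one_lt
  have hmρ : (m : ℚ) • ρ ∉ (Submodule.span ℤ (Set.range ![(⟨1, 0, 0, 0⟩ : ℍ[ℚ,-1,-7]), ⟨0, 1, 0, 0⟩, ⟨1/2, 0, 1/2, 0⟩, ⟨0, 1/2, 0, 1/2⟩])) := fun h => absurd (hmin m hm0 h) (not_le.2 hmn)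
  -- `δ := nρ`, `δ/p = mρ`
  have hδ : (p : ℚ)⁻¹ • ((n : ℚ) • ρ) = (m : ℚ) • ρ := by
    rw [smul_smul, hm, Nat.cast_mul, ← mul_assoc, inv_mul_cancel₀ (by exact_mod_cast hp.ne_zero), one_mul]
  have hnot : (p : ℚ)⁻¹ • ((n : ℚ) • ρ) ∉ (Submodule.span ℤ (Set.range ![(⟨1, 0, 0, 0⟩ : ℍ[ℚ,-1,-7]), ⟨0, 1, 0, 0⟩, ⟨1/2, 0, 1/2, 0⟩, ⟨0, 1/2, 0, 1/2⟩])) := by rw [hδ]; exact hmρ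
  obtain ⟨α, hα, β, hβ, h1, h2⟩ := exists_alpha_beta_of_prime hp hn hnot
  refine ⟨(m : ℚ) • α, ?_, β, hβ, ?_⟩
  · rw [Nat.cast_smul_eq_nsmul]
    exact ((Submodule.span ℤ (Set.range ![(⟨1, 0, 0, 0⟩ : ℍ[ℚ,-1,-7]), ⟨0, 1, 0, 0⟩, ⟨1/2, 0, 1/2, 0⟩, ⟨0, 1/2, 0, 1/2⟩]))).nsmul_mem hα m
  · have e : ρ * ((m : ℚ) • α) - β = ((p : ℚ)⁻¹ • ((n : ℚ) • ρ)) * α - β := by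
      rw [hδ, mul_smul_comm, smul_mul_assoc]
    rw [e]
    exact ⟨h1, h2⟩

end Criterion

end Literature.NumberTheory.Automorphic.MaxOrderDiscSeven
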